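import Mathlib
import HarnessLib
import Literature.Analysis.Convex.SchauderFixedPoint

/-!
# The general Mann iterative process and the Mann iteration for quasi-nonexpansive maps in
# strictly and uniformly convex Banach spaces (Dotson 1970, Senter–Dotson 1974)

[cite: Berinde2007, Ch. 4 "The Mann Iteration", §4.1 "The general Mann iteration" and §4.2
"Nonexpansive and quasi-nonexpansive operators", pp. 89–104 of the printed book (Definitions
4.1–4.3, Lemmas 4.1, 4.2, 4.3, 4.5, Theorems 4.1, 4.2, 4.4, 4.5, 4.6, 4.8, Corollary 4.1,
Remarks and Examples); bibliographical comments §4.4, pp. 109–111]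

V. Berinde, *Iterative Approximation of Fixed Points*, 2nd ed., Lecture Notes in Mathematics
1912, Springer 2007, doi:10.1007/978-3-540-72234-2 (held: `lit` key
`book:berinde2007-iterative-approximation-fixed-points`; bib key `Berinde2007`).  The two sections
reproduce, as the book says (§4.4), W. G. Dotson Jr., *On the Mann iterative process*, Trans.
Amer. Math. Soc. **149** (1970) 65–73, doi:10.1090/S0002-9947-1970-0257828-6 (Theorems 1–5,
Lemmas 1–3) and H. F. Senter, W. G. Dotson Jr., *Approximating fixed points of nonexpansive
mappings*, Proc. Amer. Math. Soc. **44** (1974) 375–380, doi:10.1090/S0002-9939-1974-0346608-8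
(Conditions I/II, Lemma 1, Theorems 1–2); the proofs below follow those papers where the book
states a result without proof (Theorem 4.8 = Exercise 4.3).  Nothing here is new mathematics.

## What is formalised

`E` is a real normed space (`[NormedAddCommGroup E] [NormedSpace ℝ E]`); `[CompleteSpace E]`,
`[StrictConvexSpace ℝ E]`, `[UniformConvexSpace E]` are added where the source uses them.
Indices start at `0` (the book's `x_1, v_1, a_{11}` are `x 0, v 0, a 0 0`).

**§4.1, the general Mann process `M(x₁, A, T)` (Definition 4.1).**  An infinite real matrix is
`a : ℕ → ℕ → ℝ`; `IsMannMatrix a` is (A₁) + (A₂) (nonnegative, lower triangular, row sums `1`),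
`ColumnsTendstoZero a` is (A₃), `IsNormalRec a` is (A₄) of Definition 4.2 (with (A₅) appearing
as the hypothesis `a (n+1) (n+1) < 1` where it is used).  `IsMannProcess a T x₀ x v` says that
`x, v : ℕ → E` are the two sequences of the process: `x 0 = x₀`, `v n = Σ_{j ≤ n} a n j • x j`,
`x (n+1) = T (v n)`; `mannX`/`mannV` construct them (`isMannProcess_mannX`) and
`IsMannProcess.unique` shows they are determined by `(a, T, x₀)`.
* `IsMannProcess.mem`: for `C` convex with `T(C) ⊆ C` and `x₀ ∈ C` both sequences stay in `C`.
* `IsMannMatrix.tendsto_sum_smul`: the regularity (Toeplitz) property of a Mann matrix with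
  (A₃) — `x n → p ⟹ Σ_j a n j • x j → p` — which is the content of the sentence "`x_n → p ⟹
  v_n → p` since `A` is regular" in the proof of Theorem 4.1.
* **Theorem 4.1** (Dotson, Theorem 1; Mann for the matrix case): `IsMannProcess.tendsto_v`,
  `IsMannProcess.tendsto_x_of_tendsto_v`, `IsMannProcess.tendsto_x_iff` and
  `IsMannProcess.apply_eq_self_of_tendsto`: for `C` closed convex, `T` continuous on `C` with
  `T(C) ⊆ C`, either sequence converges to `p` iff the other does, and then `T p = p`.
* **Definition 4.2 / Theorem 4.2** (Dotson, Theorem 2): `IsMannProcess.v_succ` is part (c),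
  `v (n+1) = (1 - a (n+1)(n+1)) • v n + a (n+1)(n+1) • T (v n)` for a normal Mann matrix;
  `normalMatrix t` is the matrix (1) built from the diagonal `t n = a (n+1) (n+1)`
  (`normalMatrix_succ_succ_self`, closed form `normalMatrix_of_le`:
  `a n j = d_j ∏_{j ≤ i < n} (1 - t i)`), it satisfies (A₁), (A₂), (A₄)
  (`isMannMatrix_normalMatrix`, `isNormalRec_normalMatrix`) and conversely every matrix with
  (A₁), (A₂), (A₄) is of this form (`IsMannMatrix.eq_normalMatrix`) — part (b); part (a):
  under (A₅) in the form `t n < 1`, (A₃) holds iff `Σ t n` diverges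
  (`columnsTendstoZero_normalMatrix_iff`, `IsMannMatrix.columnsTendstoZero_iff`; the Picard
  alternative `a n n = 1` of (A₅) gives (A₃) trivially, `IsMannMatrix.columnsTendstoZero_of_diag`),
  via the elementary estimates `1 - Σ t i ≤ ∏ (1 - t i) ≤ exp (-Σ t i)`.

**§4.2, the normal Mann process for (quasi-)nonexpansive maps.**  Here the process is any
sequence `v : ℕ → E` with `v (n+1) = (1 - c n) • v n + c n • T (v n)` (hypothesis `hv`; by
Theorem 4.2 (c) this is the `v`-sequence of a normal Mann process with `c n = a (n+1) (n+1)`, and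
for a general normal process the results are transferred in
`IsMannProcess.exists_tendsto_of_normal`).  Quasi-nonexpansiveness of `T` on `C`
(Definition of Tricomi/Diaz–Metcalf/Dotson, book p. 98: `‖T x - p‖ ≤ ‖x - p‖` for `x ∈ C` and
every fixed point `p ∈ C`) is written out as the hypothesis
`hq : ∀ p ∈ C, T p = p → ∀ x ∈ C, ‖T x - p‖ ≤ ‖x - p‖`
(literally `IsQuasiNonexpansiveOn T C` of the anchor `QuasiNonexpansiveOperators`, unfolded), and
the fixed point set `F(T) = Fix T ∩ C` as `{p ∈ C | T p = p}`.
* `mann_mem` (the iterates stay in a convex `C`), **Lemma 4.1** (Dotson, Lemma 1; strict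
  convexity) `eq_of_norm_combo_eq`, **Lemma 4.2** (Dotson, Lemma 2) `norm_mann_succ_sub_le` /
  `antitone_norm_mann_sub` (part (i), Fejér monotonicity), `tendsto_of_antitone_of_subseq`
  (part (ii)), `norm_sub_eq_of_subseq_tendsto` (part (iii)).
* **Theorem 4.4** (Dotson, Theorem 3): `exists_tendsto_of_strictConvexSpace` — `E` strictly
  convex Banach, `C` closed convex, `T : C → C` continuous and quasi-nonexpansive, `T(C) ⊆ K`
  compact, `c n ∈ [0,1]` clustering at some `t ∈ (0,1)`: the Mann sequence converges to a fixed
  point of `T` (the fixed point the book takes from Schauder's theorem comes from the tree's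
  `Literature.Analysis.Convex.exists_fixedPoint_of_mapsTo_isCompact`, anchor `SchauderFixedPoint`);
  `IsMannProcess.exists_tendsto_of_normal` is the printed form for `M(x₁, A, T)` (both `x_n` and
  `v_n` converge).
* **Lemma 4.3** (Dotson, Lemma 3; uniform convexity with variable weights `c n ∈ [a,b] ⊂ (0,1)`):
  `exists_norm_combo_le_one_sub` (the quantitative estimate) and
  `tendsto_norm_sub_of_norm_combo_tendsto_one`.
* **Theorem 4.5** (Dotson, Theorem 4): `tendsto_norm_apply_sub_self` (`‖T v_n - v_n‖ → 0`) and
  `tendsto_mann_succ_sub` (`v_{n+1} - v_n → 0`, asymptotic regularity); **Corollary 4.1**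
  (Browder–Petryshyn 1967): `tendsto_succ_sub_of_nonexpansive`.
* **Theorem 4.6** (Dotson, Theorem 5): `tendsto_of_subseq_tendsto_of_graph_closed` — with
  `I - T` sequentially closed on `C`, every strong cluster point `y ∈ C` of `v` is a fixed point
  and `v → y`; `graph_closed_of_continuousOn` is Remark 1 (continuity of `T` suffices) and
  `tendsto_apply_of_tendsto` the remark that then also `x_{n+1} = T v_n → y`.
* **Theorem 4.7 (i)/(iii)** (Dotson 1970, §4), the parts not using reflexivity:
  `demiclosedOn`, `weaklyClosedOn` (sequential, in Mathlib's weak topology `WeakSpace ℝ E`),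
  `demiclosedOn_of_weaklyClosedOn` and `apply_eq_self_of_weak_subseq_tendsto` — every weak
  subsequential limit in `C` of the Mann sequence is a fixed point.
* **Definition 4.3** (condition (D); Senter–Dotson's Condition I): `SatisfiesConditionD T C`;
  **Lemma 4.5** (Senter–Dotson, Lemma 1): `satisfiesConditionD_of_image_closed`;
  `isClosed_fixedSet` (the fixed point set of a quasi-nonexpansive map on a closed set is closed,
  Dotson 1972 Theorem 1, used on book p. 98) and `cauchySeq_of_fejer_of_tendsto_infDist`.
* **Theorem 4.8** in the generality of Senter–Dotson, Theorem 2 (quasi-nonexpansive `T`,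
  `F(T) ≠ ∅`, condition (D), `0 < a ≤ c n ≤ b < 1`, `E` uniformly convex Banach, `C` closed
  convex): `exists_tendsto_of_conditionD`; the printed nonexpansive version (Senter–Dotson,
  Theorem 1) is `exists_tendsto_of_conditionD_of_nonexpansive`.
* **Example 4.2** (Senter–Dotson's example), the norm-only part: for a unit vector `e` the map
  `T u = ‖u‖ • e` is nonexpansive with fixed point set the ray `{r • e | 0 ≤ r}`
  (`norm_normRayMap_sub_le`, `normRayMap_eq_self_iff`), and for `α_n ≡ 1` the Mann iteration
  reaches the fixed point `‖u₀‖ • e` in one step (`normRayMap_normRayMap`).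

Deviations, declared: (i) indices from `0`; the book's `λ`/`α_n`/`a_{n+1,n+1}` is `c n`;
(ii) Theorem 4.1 is proved for a normed space (the book states it, without proof, for a locally
convex Hausdorff space — Dotson's Theorem 1; only the normed case is used later in the chapter);
(iii) in Theorem 4.8 (printed form) the fixed point the book obtains from the Browder–Göhde–Kirk
theorem (`C` bounded, `E` uniformly convex) is assumed as the hypothesis `∃ p ∈ C, T p = p` (the
tree has Browder's theorem only in Hilbert space, `BrowderCurveStrongConvergence`; for
quasi-nonexpansive maps `F(T) ≠ ∅` is part of Dotson's definition anyway, so Theorems 4.5, 4.6 and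
the general 4.8 carry the same hypothesis); in Theorem 4.4 relative compactness of `T(C)` is
phrased as `MapsTo T C K` with `K` compact, and "clusters at `t`" as the existence of a
subsequence of `c` converging to `t`;
(iv) closedness of the map `I - T` on `C` in Theorem 4.6 is the sequential closed-graph property
`graphClosedOn`, and demiclosedness / weak closedness in Theorem 4.7 are the sequential properties
`demiclosedOn` / `weaklyClosedOn`; (v) Theorem 4.3 (Rhoades' generic matrix theorem, which needs
summability matrices "equivalent to convergence"), the parts of Theorem 4.7 resting on the
reflexivity of uniformly convex spaces (existence of weak cluster points, (ii), second half of
(iii)) and the inner-product computations of Example 4.2 are not formalised.  Theorems 4.9–4.10,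
which close §4.2 (the Mann iteration of a Zamfirescu operator: by §4.4, Rhoades [Rh74a, Thm 4] in
a uniformly convex space under `Σ α_n (1 - α_n) = ∞`, and Berinde [Be03e, Thm 2] in an arbitrary
Banach space under `Σ α_n = ∞`), are outside the scope of this file: Theorem 4.10 is the tree's
`Literature.Analysis.Convex.ConvergenceRateComparison.tendsto_mannSeq_zam` (for a Zamfirescu mapping
with a given fixed point), whose hypothesis `Σ α_n = ∞` follows from that of Theorem 4.9 since
`α_n (1 - α_n) ≤ α_n`.
(vi) A remark on Example 4.2, item 2): the book's polar bookkeeping `r_{n+1} = r_n` treats the Mann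
step as a convex combination of polar coordinates; in the Euclidean plane (indeed in any strictly
convex space) the Mann step `u₁ = (1 - α) u₀ + α T u₀` with `0 < α < 1` and `u₀ ≠ T u₀`,
`‖T u₀‖ = ‖u₀‖`, has `‖u₁‖ < ‖u₀‖` (`norm_mann_step_lt`), so the iterates leave the unit circle and
the printed limit `(1, π/2)` is not the actual limit; the qualitative conclusion of the example
(the limit need not be the nearest fixed point) is unaffected.  Floating point is not modelled.
-/

open Filter Topology Set Metric

namespace Literature.Analysis.Convex.MannQuasiNonexpansive

variable {E : Type*} [NormedAddCommGroup E] [NormedSpace ℝ E]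

/-! ## §4.1 The general Mann iterative process -/

section General

variable {a : ℕ → ℕ → ℝ} {T : E → E} {x₀ : E} {x v : ℕ → E} {C : Set E}

/-- (A₁) + (A₂) of **Definition 4.1**: a nonnegative, lower triangular infinite matrix with row
sums `1`.
[cite: Berinde2007, Ch. 4 §4.1, Definition 4.1, pp. 89–93] -/
structure IsMannMatrix (a : ℕ → ℕ → ℝ) : Prop where
  nonneg : ∀ n j, 0 ≤ a n j
  eq_zero_of_lt : ∀ ⦃n j⦄, n < j → a n j = 0
  sum_eq_one : ∀ n, ∑ j ∈ Finset.range (n + 1), a n j = 1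

/-- (A₃) of **Definition 4.1**: every column tends to `0`.
[cite: Berinde2007, Ch. 4 §4.1, Definition 4.1, pp. 89–93] -/
def ColumnsTendstoZero (a : ℕ → ℕ → ℝ) : Prop :=
  ∀ j, Tendsto (fun n => a n j) atTop (𝓝 0)

/-- (A₄) of **Definition 4.2** (normal Mann process):
`a (n+1) j = (1 - a (n+1) (n+1)) * a n j` for `j ≤ n`.
[cite: Berinde2007, Ch. 4 §4.1, Definition 4.2, pp. 89–93] -/
def IsNormalRec (a : ℕ → ℕ → ℝ) : Prop :=
  ∀ ⦃n j⦄, j ≤ n → a (n + 1) j = (1 - a (n + 1) (n + 1)) * a n j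

/-- **Definition 4.1**: `x` and `v` are the two sequences of the Mann iterative process
`M(x₀, A, T)`: `x 0 = x₀`, `v n = Σ_{j ≤ n} a n j • x j`, `x (n+1) = T (v n)`.
[cite: Berinde2007, Ch. 4 §4.1, Definition 4.1, pp. 89–93] -/
structure IsMannProcess (a : ℕ → ℕ → ℝ) (T : E → E) (x₀ : E) (x v : ℕ → E) : Prop where
  init : x 0 = x₀
  v_eq : ∀ n, v n = ∑ j ∈ Finset.range (n + 1), a n j • x j
  succ : ∀ n, x (n + 1) = T (v n)

/-- Entries of a Mann matrix are at most `1`.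
[cite: Berinde2007, Ch. 4 §4.1, Definition 4.1, pp. 89–93] -/
theorem IsMannMatrix.le_one (hA : IsMannMatrix a) (n j : ℕ) : a n j ≤ 1 := by
  rcases lt_or_ge n j with h | h
  · rw [hA.eq_zero_of_lt h]; exact zero_le_one
  · calc a n j ≤ ∑ i ∈ Finset.range (n + 1), a n i :=
          Finset.single_le_sum (fun i _ => hA.nonneg n i) (Finset.mem_range.2 (by omega))
      _ = 1 := hA.sum_eq_one n

/-- The diagonal entries `a (n+1) (n+1)` of a Mann matrix lie in `[0, 1]`.
[cite: Berinde2007, Ch. 4 §4.1, Definition 4.1, pp. 89–93] -/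
theorem IsMannMatrix.diag_mem_Icc (hA : IsMannMatrix a) (n : ℕ) : a n n ∈ Icc (0 : ℝ) 1 :=
  ⟨hA.nonneg n n, hA.le_one n n⟩

/-- The history of the Mann process: `mannHist a T x₀ n` lists `x 0, …, x n` (and is extended
arbitrarily beyond `n`). [cite: Berinde2007, Ch. 4 §4.1, Definition 4.1, pp. 89–93] -/
noncomputable def mannHist (a : ℕ → ℕ → ℝ) (T : E → E) (x₀ : E) : ℕ → ℕ → E
  | 0 => fun _ => x₀
  | n + 1 => Function.update (mannHist a T x₀ n) (n + 1)
      (T (∑ j ∈ Finset.range (n + 1), a n j • mannHist a T x₀ n j))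

/-- The `x`-sequence of the Mann process `M(x₀, A, T)`.
[cite: Berinde2007, Ch. 4 §4.1, Definition 4.1, pp. 89–93] -/
noncomputable def mannX (a : ℕ → ℕ → ℝ) (T : E → E) (x₀ : E) (n : ℕ) : E := mannHist a T x₀ n n

/-- The `v`-sequence `v n = Σ_{j ≤ n} a n j • x j` of the Mann process `M(x₀, A, T)`.
[cite: Berinde2007, Ch. 4 §4.1, Definition 4.1, pp. 89–93] -/
noncomputable def mannV (a : ℕ → ℕ → ℝ) (T : E → E) (x₀ : E) (n : ℕ) : E :=
  ∑ j ∈ Finset.range (n + 1), a n j • mannX a T x₀ j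

/-- The history is stable: the first `n+1` entries of `mannHist a T x₀ n` are `x 0, …, x n`.
[cite: Berinde2007, Ch. 4 §4.1, Definition 4.1, pp. 89–93] -/
theorem mannHist_stable (a : ℕ → ℕ → ℝ) (T : E → E) (x₀ : E) :
    ∀ n k, k ≤ n → mannHist a T x₀ n k = mannX a T x₀ k := by
  intro n
  induction n with
  | zero => intro k hk; obtain rfl := Nat.le_zero.1 hk; rfl
  | succ n ih =>
    intro k hk
    rcases hk.lt_or_eq with hk | rfl
    · rw [mannHist, Function.update_apply, if_neg (by omega)]
      exact ih k (by omega)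
    · rfl

/-- The constructed sequences form the Mann process (existence in Definition 4.1).
[cite: Berinde2007, Ch. 4 §4.1, Definition 4.1, pp. 89–93] -/
theorem isMannProcess_mannX (a : ℕ → ℕ → ℝ) (T : E → E) (x₀ : E) :
    IsMannProcess a T x₀ (mannX a T x₀) (mannV a T x₀) := by
  refine ⟨rfl, fun n => rfl, fun n => ?_⟩
  show mannHist a T x₀ (n + 1) (n + 1) = T (mannV a T x₀ n)
  rw [mannHist, Function.update_apply, if_pos rfl, mannV]
  congr 1
  refine Finset.sum_congr rfl fun j hj => ?_
  rw [mannHist_stable a T x₀ n j (by have := Finset.mem_range.1 hj; omega)]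

/-- The process `M(x₀, A, T)` is determined by `(A, T, x₀)`.
[cite: Berinde2007, Ch. 4 §4.1, Definition 4.1, pp. 89–93] -/
theorem IsMannProcess.unique {x' v' : ℕ → E} (hP : IsMannProcess a T x₀ x v)
    (hP' : IsMannProcess a T x₀ x' v') : x = x' ∧ v = v' := by
  have key : ∀ n, ∀ k ≤ n, x k = x' k := by
    intro n
    induction n with
    | zero => intro k hk; obtain rfl := Nat.le_zero.1 hk; rw [hP.init, hP'.init]
    | succ n ih =>
      intro k hk
      rcases hk.lt_or_eq with hk | rfl
      · exact ih k (by omega)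
      · rw [hP.succ, hP'.succ, hP.v_eq, hP'.v_eq]
        congr 1
        exact Finset.sum_congr rfl fun j hj =>
          by rw [ih j (by have := Finset.mem_range.1 hj; omega)]
  have hx : x = x' := funext fun n => key n n le_rfl
  refine ⟨hx, funext fun n => ?_⟩
  rw [hP.v_eq, hP'.v_eq, hx]

/-- For `C` convex, `T(C) ⊆ C`, `x₀ ∈ C`, both sequences of `M(x₀, A, T)` stay in `C`
(implicit in Definition 4.1, where `T : C → C`).
[cite: Berinde2007, Ch. 4 §4.1, Definition 4.1, pp. 89–93] -/
theorem IsMannProcess.mem (hP : IsMannProcess a T x₀ x v) (hA : IsMannMatrix a)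
    (hconv : Convex ℝ C) (hTC : MapsTo T C C) (hx₀ : x₀ ∈ C) :
    (∀ n, x n ∈ C) ∧ ∀ n, v n ∈ C := by
  have hv : ∀ n, (∀ k ≤ n, x k ∈ C) → v n ∈ C := fun n hn => by
    rw [hP.v_eq]
    exact hconv.sum_mem (fun j _ => hA.nonneg n j) (hA.sum_eq_one n)
      fun j hj => hn j (by have := Finset.mem_range.1 hj; omega)
  have key : ∀ n, ∀ k ≤ n, x k ∈ C := by
    intro n
    induction n with
    | zero => intro k hk; obtain rfl := Nat.le_zero.1 hk; rw [hP.init]; exact hx₀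
    | succ n ih =>
      intro k hk
      rcases hk.lt_or_eq with hk | rfl
      · exact ih k (by omega)
      · rw [hP.succ]; exact hTC (hv n ih)
  exact ⟨fun n => key n n le_rfl, fun n => hv n (key n)⟩

/-- Regularity of a Mann matrix (the Toeplitz property used in the proof of Theorem 4.1):
(A₁)–(A₃) imply `x n → p ⟹ Σ_{j ≤ n} a n j • x j → p`.
[cite: Berinde2007, Ch. 4 §4.1, proof of Theorem 4.1, pp. 89–93 ("since `A` is regular")] -/
theorem IsMannMatrix.tendsto_sum_smul (hA : IsMannMatrix a) (h3 : ColumnsTendstoZero a)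
    {x : ℕ → E} {p : E} (hx : Tendsto x atTop (𝓝 p)) :
    Tendsto (fun n => ∑ j ∈ Finset.range (n + 1), a n j • x j) atTop (𝓝 p) := by
  rw [tendsto_iff_norm_sub_tendsto_zero] at hx ⊢
  have hid : ∀ n, (∑ j ∈ Finset.range (n + 1), a n j • x j) - p =
      ∑ j ∈ Finset.range (n + 1), a n j • (x j - p) := fun n => by
    rw [Finset.sum_congr rfl fun j _ => smul_sub (a n j) (x j) p, Finset.sum_sub_distrib,
      ← Finset.sum_smul, hA.sum_eq_one, one_smul]
  refine Metric.tendsto_atTop.2 fun ε hε => ?_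
  obtain ⟨J, hJ⟩ := Metric.tendsto_atTop.1 hx (ε / 2) (half_pos hε)
  have hhead : Tendsto (fun n => ∑ j ∈ Finset.range J, a n j * ‖x j - p‖) atTop (𝓝 0) := by
    have := tendsto_finsetSum (Finset.range J) fun j _ => (h3 j).mul_const ‖x j - p‖
    simpa using this
  obtain ⟨N, hN⟩ := Metric.tendsto_atTop.1 hhead (ε / 2) (half_pos hε)
  refine ⟨N, fun n hn => ?_⟩
  have hN' := hN n hn
  rw [Real.dist_0_eq_abs, abs_of_nonneg (Finset.sum_nonneg fun j _ =>
    mul_nonneg (hA.nonneg n j) (norm_nonneg _))] at hN'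
  -- the head of the sum, written over `range (n+1)` with a cut-off
  have hswitch : ∑ j ∈ Finset.range (n + 1), a n j * (if j < J then ‖x j - p‖ else 0) =
      ∑ j ∈ Finset.range J, a n j * ‖x j - p‖ := by
    have h1 : ∑ j ∈ Finset.range (n + 1), a n j * (if j < J then ‖x j - p‖ else 0) =
        ∑ j ∈ Finset.range (max (n + 1) J), a n j * (if j < J then ‖x j - p‖ else 0) :=
      Finset.sum_subset (Finset.range_subset_range.2 (le_max_left _ _)) fun j _ hj => by
        rw [hA.eq_zero_of_lt (by have := mt Finset.mem_range.2 hj; omega), zero_mul]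
    have h2 : ∑ j ∈ Finset.range J, a n j * ‖x j - p‖ =
        ∑ j ∈ Finset.range (max (n + 1) J), a n j * (if j < J then ‖x j - p‖ else 0) :=
      calc ∑ j ∈ Finset.range J, a n j * ‖x j - p‖
          = ∑ j ∈ Finset.range J, a n j * (if j < J then ‖x j - p‖ else 0) :=
            Finset.sum_congr rfl fun j hj => by rw [if_pos (Finset.mem_range.1 hj)]
        _ = ∑ j ∈ Finset.range (max (n + 1) J), a n j * (if j < J then ‖x j - p‖ else 0) :=
            Finset.sum_subset (Finset.range_subset_range.2 (le_max_right _ _)) fun j _ hj => by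
              rw [if_neg (fun h => hj (Finset.mem_range.2 h)), mul_zero]
    rw [h1, h2]
  rw [Real.dist_0_eq_abs, abs_of_nonneg (norm_nonneg _), hid]
  calc ‖∑ j ∈ Finset.range (n + 1), a n j • (x j - p)‖
      ≤ ∑ j ∈ Finset.range (n + 1), a n j * ‖x j - p‖ :=
        norm_sum_le_of_le _ fun j _ => by rw [norm_smul, Real.norm_of_nonneg (hA.nonneg n j)]
    _ ≤ ∑ j ∈ Finset.range (n + 1),
          (a n j * (if j < J then ‖x j - p‖ else 0) + a n j * (ε / 2)) := by
        refine Finset.sum_le_sum fun j _ => ?_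
        split_ifs with hj
        · exact le_add_of_nonneg_right (mul_nonneg (hA.nonneg n j) (half_pos hε).le)
        · have h := hJ j (not_lt.1 hj)
          rw [Real.dist_0_eq_abs, abs_of_nonneg (norm_nonneg _)] at h
          rw [mul_zero, zero_add]
          exact mul_le_mul_of_nonneg_left h.le (hA.nonneg n j)
    _ = ∑ j ∈ Finset.range J, a n j * ‖x j - p‖ + ε / 2 := by
        rw [Finset.sum_add_distrib, ← Finset.sum_mul, hA.sum_eq_one, one_mul, hswitch]
    _ < ε / 2 + ε / 2 := by linarith
    _ = ε := by ring

/-- **Theorem 4.1**, first half: if `x n → p` then `v n → p`.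
[cite: Berinde2007, Ch. 4 §4.1, Theorem 4.1, pp. 89–93] -/
theorem IsMannProcess.tendsto_v (hP : IsMannProcess a T x₀ x v) (hA : IsMannMatrix a)
    (h3 : ColumnsTendstoZero a) {p : E} (hx : Tendsto x atTop (𝓝 p)) :
    Tendsto v atTop (𝓝 p) := by
  rw [show v = fun n => ∑ j ∈ Finset.range (n + 1), a n j • x j from funext hP.v_eq]
  exact hA.tendsto_sum_smul h3 hx

/-- **Theorem 4.1**, second half: `C` closed convex, `T` continuous on `C` with `T(C) ⊆ C`,
`x₀ ∈ C`; if `v n → p` then `p ∈ C`, `T p = p` and `x n → p`.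
[cite: Berinde2007, Ch. 4 §4.1, Theorem 4.1, pp. 89–93] -/
theorem IsMannProcess.tendsto_x_of_tendsto_v (hP : IsMannProcess a T x₀ x v) (hA : IsMannMatrix a)
    (h3 : ColumnsTendstoZero a) (hC : IsClosed C) (hconv : Convex ℝ C) (hTC : MapsTo T C C)
    (hT : ContinuousOn T C) (hx₀ : x₀ ∈ C) {p : E} (hv : Tendsto v atTop (𝓝 p)) :
    p ∈ C ∧ T p = p ∧ Tendsto x atTop (𝓝 p) := by
  obtain ⟨-, hvC⟩ := hP.mem hA hconv hTC hx₀
  have hpC : p ∈ C := hC.mem_of_tendsto hv (Eventually.of_forall hvC)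
  have hTv : Tendsto (fun n => T (v n)) atTop (𝓝 (T p)) :=
    (hT p hpC).tendsto.comp (tendsto_nhdsWithin_iff.2 ⟨hv, Eventually.of_forall hvC⟩)
  have hx1 : Tendsto (fun n => x (n + 1)) atTop (𝓝 (T p)) := by
    simpa only [hP.succ] using hTv
  have hx' : Tendsto x atTop (𝓝 (T p)) := (tendsto_add_atTop_iff_nat 1).1 hx1
  have hTp : T p = p := tendsto_nhds_unique (hP.tendsto_v hA h3 hx') hv
  exact ⟨hpC, hTp, hTp ▸ hx'⟩

/-- **Theorem 4.1**: under the hypotheses of the second half, `x n → p ↔ v n → p`.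
[cite: Berinde2007, Ch. 4 §4.1, Theorem 4.1, pp. 89–93] -/
theorem IsMannProcess.tendsto_x_iff (hP : IsMannProcess a T x₀ x v) (hA : IsMannMatrix a)
    (h3 : ColumnsTendstoZero a) (hC : IsClosed C) (hconv : Convex ℝ C) (hTC : MapsTo T C C)
    (hT : ContinuousOn T C) (hx₀ : x₀ ∈ C) {p : E} :
    Tendsto x atTop (𝓝 p) ↔ Tendsto v atTop (𝓝 p) :=
  ⟨hP.tendsto_v hA h3, fun h => (hP.tendsto_x_of_tendsto_v hA h3 hC hconv hTC hT hx₀ h).2.2⟩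

/-- **Theorem 4.1**, conclusion: if either sequence converges to `p`, then `p ∈ C` is a fixed
point of `T`. [cite: Berinde2007, Ch. 4 §4.1, Theorem 4.1, pp. 89–93] -/
theorem IsMannProcess.apply_eq_self_of_tendsto (hP : IsMannProcess a T x₀ x v)
    (hA : IsMannMatrix a) (h3 : ColumnsTendstoZero a) (hC : IsClosed C) (hconv : Convex ℝ C)
    (hTC : MapsTo T C C) (hT : ContinuousOn T C) (hx₀ : x₀ ∈ C) {p : E}
    (h : Tendsto x atTop (𝓝 p) ∨ Tendsto v atTop (𝓝 p)) : p ∈ C ∧ T p = p := by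
  have hv : Tendsto v atTop (𝓝 p) := h.elim (hP.tendsto_v hA h3) id
  have := hP.tendsto_x_of_tendsto_v hA h3 hC hconv hTC hT hx₀ hv
  exact ⟨this.1, this.2.1⟩

/-! ### Definition 4.2, Theorem 4.2: normal Mann processes -/

/-- **Theorem 4.2 (c)**: for a matrix with (A₄) the `v`-sequence satisfies
`v (n+1) = (1 - a (n+1)(n+1)) • v n + a (n+1)(n+1) • T (v n)`.
[cite: Berinde2007, Ch. 4 §4.1, Theorem 4.2 (c), pp. 89–93] -/
theorem IsMannProcess.v_succ (hP : IsMannProcess a T x₀ x v) (h4 : IsNormalRec a) (n : ℕ) :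
    v (n + 1) = (1 - a (n + 1) (n + 1)) • v n + a (n + 1) (n + 1) • T (v n) := by
  rw [hP.v_eq (n + 1), Finset.sum_range_succ, ← hP.succ n, hP.v_eq n, Finset.smul_sum]
  congr 1
  refine Finset.sum_congr rfl fun j hj => ?_
  rw [h4 (by have := Finset.mem_range.1 hj; omega), mul_smul]

/-- `v 0 = x 0` for a Mann process. [cite: Berinde2007, Ch. 4 §4.1, Definition 4.1, pp. 89–93] -/
theorem IsMannProcess.v_zero (hP : IsMannProcess a T x₀ x v) (hA : IsMannMatrix a) :
    v 0 = x₀ := by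
  have h := hA.sum_eq_one 0
  rw [Finset.sum_range_one] at h
  rw [hP.v_eq, Finset.sum_range_one, h, one_smul, hP.init]

/-- The diagonal weights of the matrix (1) of Theorem 4.2 (b): `d 0 = 1`, `d (j+1) = t j`
(the book's `a_{11} = 1`, `a_{jj} = c_j`).
[cite: Berinde2007, Ch. 4 §4.1, Theorem 4.2 (b), pp. 89–93] -/
def normalDiag (t : ℕ → ℝ) : ℕ → ℝ
  | 0 => 1
  | j + 1 => t j

/-- The matrix (1) of **Theorem 4.2 (b)** built from a sequence `t` (the book's `c_n`):
`a n j = d j ∏_{j ≤ i < n} (1 - t i)` for `j ≤ n`, `0` above the diagonal.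
[cite: Berinde2007, Ch. 4 §4.1, Theorem 4.2 (b), display (1), pp. 89–93] -/
noncomputable def normalMatrix (t : ℕ → ℝ) (n j : ℕ) : ℝ :=
  if j ≤ n then normalDiag t j * ∏ i ∈ Finset.Ico j n, (1 - t i) else 0

section NormalMatrix

variable {t : ℕ → ℝ}

/-- The matrix (1) is lower triangular.
[cite: Berinde2007, Ch. 4 §4.1, Theorem 4.2 (b), pp. 89–93] -/
theorem normalMatrix_of_lt {n j : ℕ} (h : n < j) : normalMatrix t n j = 0 := if_neg (not_le.2 h)

/-- The closed form of the matrix (1) on and below the diagonal.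
[cite: Berinde2007, Ch. 4 §4.1, Theorem 4.2 (b), display (1), pp. 89–93] -/
theorem normalMatrix_of_le {n j : ℕ} (h : j ≤ n) :
    normalMatrix t n j = normalDiag t j * ∏ i ∈ Finset.Ico j n, (1 - t i) := if_pos h

/-- The diagonal of the matrix (1). [cite: Berinde2007, Ch. 4 §4.1, Theorem 4.2 (b), pp. 89–93] -/
theorem normalMatrix_self (n : ℕ) : normalMatrix t n n = normalDiag t n := by
  rw [normalMatrix_of_le le_rfl, Finset.Ico_self, Finset.prod_empty, mul_one]

/-- `a 0 0 = 1`. [cite: Berinde2007, Ch. 4 §4.1, Theorem 4.2 (b), display (1), pp. 89–93] -/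
theorem normalMatrix_zero_zero : normalMatrix t 0 0 = 1 := normalMatrix_self 0

/-- `a (n+1) (n+1) = t n`: the diagonal is the given sequence.
[cite: Berinde2007, Ch. 4 §4.1, Theorem 4.2 (b), pp. 89–93] -/
theorem normalMatrix_succ_succ_self (n : ℕ) : normalMatrix t (n + 1) (n + 1) = t n :=
  normalMatrix_self (n + 1)

/-- (A₄) for the matrix (1): `a (n+1) j = (1 - t n) * a n j` for `j ≤ n`.
[cite: Berinde2007, Ch. 4 §4.1, Theorem 4.2 (b), pp. 89–93] -/
theorem normalMatrix_succ_of_le {n j : ℕ} (h : j ≤ n) :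
    normalMatrix t (n + 1) j = (1 - t n) * normalMatrix t n j := by
  rw [normalMatrix_of_le (h.trans n.le_succ), Finset.prod_Ico_succ_top h, normalMatrix_of_le h]
  ring

/-- The matrix (1) satisfies (A₄). [cite: Berinde2007, Ch. 4 §4.1, Theorem 4.2 (b), pp. 89–93] -/
theorem isNormalRec_normalMatrix (t : ℕ → ℝ) : IsNormalRec (normalMatrix t) := by
  intro n j h
  rw [normalMatrix_succ_succ_self, normalMatrix_succ_of_le h]

/-- The matrix (1) has row sums `1`. [cite: Berinde2007, Ch. 4 §4.1, Theorem 4.2 (b), pp. 89–93] -/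
theorem normalMatrix_sum (t : ℕ → ℝ) (n : ℕ) :
    ∑ j ∈ Finset.range (n + 1), normalMatrix t n j = 1 := by
  induction n with
  | zero => rw [Finset.sum_range_one, normalMatrix_zero_zero]
  | succ n ih =>
    rw [Finset.sum_range_succ, normalMatrix_succ_succ_self,
      Finset.sum_congr rfl fun j hj =>
        normalMatrix_succ_of_le (t := t) (by have := Finset.mem_range.1 hj; omega),
      ← Finset.mul_sum, ih]
    ring

/-- The first column of the matrix (1): `a n 0 = ∏_{i < n} (1 - t i)`.
[cite: Berinde2007, Ch. 4 §4.1, Theorem 4.2 (a)/(b), pp. 89–93] -/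
theorem normalMatrix_zero_right (n : ℕ) :
    normalMatrix t n 0 = ∏ i ∈ Finset.range n, (1 - t i) := by
  rw [normalMatrix_of_le n.zero_le, normalDiag, one_mul, Finset.range_eq_Ico]

/-- [cite: Berinde2007, Ch. 4 §4.1, Theorem 4.2 (b), pp. 89–93] -/
theorem normalDiag_nonneg (h0 : ∀ n, 0 ≤ t n) : ∀ j, 0 ≤ normalDiag t j
  | 0 => zero_le_one
  | j + 1 => h0 j

/-- For `0 ≤ t n ≤ 1` the matrix (1) satisfies (A₁) and (A₂).
[cite: Berinde2007, Ch. 4 §4.1, Theorem 4.2 (b), pp. 89–93] -/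
theorem isMannMatrix_normalMatrix (h0 : ∀ n, 0 ≤ t n) (h1 : ∀ n, t n ≤ 1) :
    IsMannMatrix (normalMatrix t) where
  nonneg n j := by
    unfold normalMatrix
    split_ifs
    · exact mul_nonneg (normalDiag_nonneg h0 j)
        (Finset.prod_nonneg fun i _ => sub_nonneg.2 (h1 i))
    · exact le_rfl
  eq_zero_of_lt _ _ h := normalMatrix_of_lt h
  sum_eq_one := normalMatrix_sum t

/-- **Theorem 4.2 (b)**: a matrix with (A₁), (A₂), (A₄) is the matrix (1) built from its
diagonal `t n = a (n+1) (n+1)` (the entries are determined by the diagonal).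
[cite: Berinde2007, Ch. 4 §4.1, Theorem 4.2 (b), pp. 89–93] -/
theorem IsMannMatrix.eq_normalMatrix (hA : IsMannMatrix a) (h4 : IsNormalRec a) :
    a = normalMatrix fun n => a (n + 1) (n + 1) := by
  funext n
  induction n with
  | zero =>
    funext j
    cases j with
    | zero =>
      have h := hA.sum_eq_one 0
      rw [Finset.sum_range_one] at h
      rw [h, normalMatrix_zero_zero]
    | succ j => rw [hA.eq_zero_of_lt (Nat.succ_pos j), normalMatrix_of_lt (Nat.succ_pos j)]
  | succ n ih =>
    funext j
    rcases lt_trichotomy j (n + 1) with hj | rfl | hj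
    · rw [h4 (show j ≤ n by omega), normalMatrix_succ_of_le (show j ≤ n by omega), ← ih]
    · rw [normalMatrix_succ_succ_self]
    · rw [hA.eq_zero_of_lt hj, normalMatrix_of_lt hj]

/-! #### Theorem 4.2 (a): (A₃) holds iff `Σ t n = ∞` -/

/-- Weierstrass' inequality `1 - Σ t i ≤ ∏ (1 - t i)` for `0 ≤ t i ≤ 1`.
[cite: Berinde2007, Ch. 4 §4.1, proof of Theorem 4.2 (a) (Dotson 1970, Theorem 2), pp. 89–93] -/
theorem one_sub_sum_le_prod_one_sub (h0 : ∀ n, 0 ≤ t n) (h1 : ∀ n, t n ≤ 1) (s : Finset ℕ) :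
    1 - ∑ i ∈ s, t i ≤ ∏ i ∈ s, (1 - t i) := by
  classical
  induction s using Finset.induction_on with
  | empty => simp
  | insert k s hk ih =>
    rw [Finset.sum_insert hk, Finset.prod_insert hk]
    have hs : 0 ≤ ∑ i ∈ s, t i := Finset.sum_nonneg fun i _ => h0 i
    have hk1 : 0 ≤ 1 - t k := sub_nonneg.2 (h1 k)
    nlinarith [mul_nonneg hk1 (sub_nonneg.2 ih), mul_nonneg (h0 k) hs]

/-- `∏ (1 - t i) ≤ exp (-Σ t i)` for `t i ≤ 1`.
[cite: Berinde2007, Ch. 4 §4.1, proof of Theorem 4.2 (a) (Dotson 1970, Theorem 2), pp. 89–93] -/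
theorem prod_one_sub_le_exp_neg_sum (h1 : ∀ n, t n ≤ 1) (s : Finset ℕ) :
    ∏ i ∈ s, (1 - t i) ≤ Real.exp (-∑ i ∈ s, t i) := by
  rw [← Finset.sum_neg_distrib, Real.exp_sum]
  exact Finset.prod_le_prod (fun i _ => sub_nonneg.2 (h1 i)) fun i _ => Real.one_sub_le_exp_neg _

/-- If `Σ t n = ∞` (`t n ≤ 1`) then `∏_{j ≤ i < n} (1 - t i) → 0` for every `j`.
[cite: Berinde2007, Ch. 4 §4.1, proof of Theorem 4.2 (a), pp. 89–93] -/
theorem tendsto_prod_Ico_one_sub (h1 : ∀ n, t n ≤ 1)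
    (hdiv : Tendsto (fun n => ∑ i ∈ Finset.range n, t i) atTop atTop) (j : ℕ) :
    Tendsto (fun n => ∏ i ∈ Finset.Ico j n, (1 - t i)) atTop (𝓝 0) := by
  have hexp : Tendsto (fun n => Real.exp (-(∑ i ∈ Finset.range n, t i -
      ∑ i ∈ Finset.range j, t i))) atTop (𝓝 0) :=
    Real.tendsto_exp_neg_atTop_nhds_zero.comp
      (tendsto_atTop_add_const_right atTop (-∑ i ∈ Finset.range j, t i) hdiv)
  refine squeeze_zero' (Eventually.of_forall fun n => Finset.prod_nonneg fun i _ =>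
    sub_nonneg.2 (h1 i)) ?_ hexp
  filter_upwards [eventually_ge_atTop j] with n hn
  rw [← Finset.sum_Ico_eq_sub _ hn]
  exact prod_one_sub_le_exp_neg_sum h1 _

/-- **Theorem 4.2 (a)**, sufficiency: if `t n ≤ 1` and `Σ t n = ∞` then the matrix (1)
satisfies (A₃). [cite: Berinde2007, Ch. 4 §4.1, Theorem 4.2 (a), pp. 89–93] -/
theorem columnsTendstoZero_normalMatrix (h1 : ∀ n, t n ≤ 1)
    (hdiv : Tendsto (fun n => ∑ i ∈ Finset.range n, t i) atTop atTop) :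
    ColumnsTendstoZero (normalMatrix t) := by
  intro j
  have h := (tendsto_prod_Ico_one_sub h1 hdiv j).const_mul (normalDiag t j)
  rw [mul_zero] at h
  refine h.congr' ?_
  filter_upwards [eventually_ge_atTop j] with n hn
  rw [normalMatrix_of_le hn]

/-- **Theorem 4.2 (a)**, necessity: if `0 ≤ t n < 1` and the matrix (1) satisfies (A₃), then
`Σ t n = ∞`. [cite: Berinde2007, Ch. 4 §4.1, Theorem 4.2 (a), pp. 89–93] -/
theorem tendsto_sum_atTop_of_columnsTendstoZero (h0 : ∀ n, 0 ≤ t n) (h1 : ∀ n, t n < 1)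
    (h3 : ColumnsTendstoZero (normalMatrix t)) :
    Tendsto (fun n => ∑ i ∈ Finset.range n, t i) atTop atTop := by
  by_contra hnot
  have hsum : Summable t := (summable_iff_not_tendsto_nat_atTop_of_nonneg h0).2 hnot
  have hcau := hsum.tendsto_sum_tsum_nat.cauchySeq
  obtain ⟨N, hN⟩ := Metric.cauchySeq_iff'.1 hcau (1 / 2) one_half_pos
  -- the first column is `P n = ∏_{i<n} (1 - t i)`, bounded below by `P N / 2` for `n ≥ N`
  have hcol : Tendsto (fun n => ∏ i ∈ Finset.range n, (1 - t i)) atTop (𝓝 0) :=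
    (h3 0).congr fun n => normalMatrix_zero_right n
  have hPN : 0 < ∏ i ∈ Finset.range N, (1 - t i) :=
    Finset.prod_pos fun i _ => sub_pos.2 (h1 i)
  have hlow : ∀ n ≥ N, (∏ i ∈ Finset.range N, (1 - t i)) / 2 ≤ ∏ i ∈ Finset.range n, (1 - t i) := by
    intro n hn
    have htail : ∑ i ∈ Finset.Ico N n, t i < 1 / 2 := by
      have h := hN n hn
      rw [Real.dist_eq] at h
      rw [Finset.sum_Ico_eq_sub _ hn]
      exact (le_abs_self _).trans_lt h
    rw [← Finset.prod_range_mul_prod_Ico _ hn]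
    have hw := one_sub_sum_le_prod_one_sub h0 (fun n => (h1 n).le) (Finset.Ico N n)
    nlinarith
  obtain ⟨M, hM⟩ := Metric.tendsto_atTop.1 hcol _ (half_pos hPN)
  have h := hM (max M N) (le_max_left _ _)
  rw [Real.dist_0_eq_abs, abs_lt] at h
  linarith [hlow (max M N) (le_max_right _ _), h.2]

/-- **Theorem 4.2 (a)** for the matrix (1) with `0 ≤ t n < 1`: (A₃) `↔ Σ t n = ∞`.
[cite: Berinde2007, Ch. 4 §4.1, Theorem 4.2 (a), pp. 89–93] -/
theorem columnsTendstoZero_normalMatrix_iff (h0 : ∀ n, 0 ≤ t n) (h1 : ∀ n, t n < 1) :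
    ColumnsTendstoZero (normalMatrix t) ↔
      Tendsto (fun n => ∑ i ∈ Finset.range n, t i) atTop atTop :=
  ⟨tendsto_sum_atTop_of_columnsTendstoZero h0 h1,
    columnsTendstoZero_normalMatrix fun n => (h1 n).le⟩

end NormalMatrix

/-- **Theorem 4.2 (a)**: for a Mann matrix with (A₄) and (A₅) in the form `a (n+1)(n+1) < 1`,
(A₃) holds iff `Σ_n a (n+1) (n+1)` diverges.
[cite: Berinde2007, Ch. 4 §4.1, Theorem 4.2 (a), pp. 89–93] -/
theorem IsMannMatrix.columnsTendstoZero_iff (hA : IsMannMatrix a) (h4 : IsNormalRec a)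
    (h5 : ∀ n, a (n + 1) (n + 1) < 1) :
    ColumnsTendstoZero a ↔
      Tendsto (fun n => ∑ i ∈ Finset.range n, a (i + 1) (i + 1)) atTop atTop := by
  have key := columnsTendstoZero_normalMatrix_iff (t := fun n => a (n + 1) (n + 1))
    (fun n => hA.nonneg _ _) h5
  rwa [← hA.eq_normalMatrix h4] at key

/-- The other alternative of (A₅): if `a n n = 1` for all `n` (the Picard iteration), the matrix
is the identity and (A₃) holds.
[cite: Berinde2007, Ch. 4 §4.1, Definition 4.2 / Remark, pp. 89–93] -/
theorem IsMannMatrix.columnsTendstoZero_of_diag (hA : IsMannMatrix a) (hd : ∀ n, a n n = 1) :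
    ColumnsTendstoZero a := by
  have hoff : ∀ n j, j < n → a n j = 0 := by
    intro n j hj
    have h := hA.sum_eq_one n
    rw [Finset.sum_range_succ, hd, add_eq_right,
      Finset.sum_eq_zero_iff_of_nonneg fun i _ => hA.nonneg n i] at h
    exact h j (Finset.mem_range.2 hj)
  intro j
  refine tendsto_const_nhds.congr' ?_
  filter_upwards [eventually_gt_atTop j] with n hn
  exact (hoff n j hn).symm

end General

/-! ## §4.2 The normal Mann iteration for quasi-nonexpansive maps -/

section Normal

variable {C : Set E} {T : E → E} {c : ℕ → ℝ} {v : ℕ → E}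

/-- The Mann iterates `v (n+1) = (1 - c n) v n + c n T (v n)`, `c n ∈ [0,1]`, stay in a convex
set `C` with `T(C) ⊆ C`. [cite: Berinde2007, Ch. 4 §4.2, pp. 93–104 (`T : C → C`, `C` convex)] -/
theorem mann_mem (hconv : Convex ℝ C) (hTC : MapsTo T C C) (hc : ∀ n, c n ∈ Icc (0 : ℝ) 1)
    (hv0 : v 0 ∈ C) (hv : ∀ n, v (n + 1) = (1 - c n) • v n + c n • T (v n)) :
    ∀ n, v n ∈ C
  | 0 => hv0
  | n + 1 => by
    rw [hv n]
    exact hconv (mann_mem hconv hTC hc hv0 hv n) (hTC (mann_mem hconv hTC hc hv0 hv n))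
      (sub_nonneg.2 (hc n).2) (hc n).1 (sub_add_cancel 1 (c n))

/-- **Lemma 4.1** (Dotson, Lemma 1): in a strictly convex space, if `‖w‖ ≤ ‖u‖`, `0 < t < 1`
and `‖(1 - t) u + t w‖ = ‖u‖`, then `u = w`.
[cite: Berinde2007, Ch. 4 §4.2, Lemma 4.1, pp. 93–104] -/
theorem eq_of_norm_combo_eq [StrictConvexSpace ℝ E] {u w : E} {t : ℝ} (ht : t ∈ Ioo (0 : ℝ) 1)
    (hle : ‖w‖ ≤ ‖u‖) (heq : ‖(1 - t) • u + t • w‖ = ‖u‖) : u = w := by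
  by_contra hne
  have h := norm_combo_lt_of_ne le_rfl hle hne (sub_pos.2 ht.2) ht.1 (sub_add_cancel 1 t)
  exact h.ne heq

/-- **Lemma 4.2 (i)** (one step): if `‖T (v n) - p‖ ≤ ‖v n - p‖` and `c n ∈ [0,1]` then
`‖v (n+1) - p‖ ≤ ‖v n - p‖`. [cite: Berinde2007, Ch. 4 §4.2, Lemma 4.2, pp. 93–104] -/
theorem norm_mann_succ_sub_le {n : ℕ} {p : E} (hc : c n ∈ Icc (0 : ℝ) 1)
    (hq : ‖T (v n) - p‖ ≤ ‖v n - p‖) (hv : v (n + 1) = (1 - c n) • v n + c n • T (v n)) :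
    ‖v (n + 1) - p‖ ≤ ‖v n - p‖ := by
  have hid : v (n + 1) - p = (1 - c n) • (v n - p) + c n • (T (v n) - p) := by
    rw [hv]; module
  rw [hid]
  calc ‖(1 - c n) • (v n - p) + c n • (T (v n) - p)‖
      ≤ ‖(1 - c n) • (v n - p)‖ + ‖c n • (T (v n) - p)‖ := norm_add_le _ _
    _ = (1 - c n) * ‖v n - p‖ + c n * ‖T (v n) - p‖ := by
        rw [norm_smul, norm_smul, Real.norm_of_nonneg (sub_nonneg.2 hc.2),
          Real.norm_of_nonneg hc.1]
    _ ≤ (1 - c n) * ‖v n - p‖ + c n * ‖v n - p‖ := by gcongr; exact hc.1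
    _ = ‖v n - p‖ := by ring

/-- **Lemma 4.2 (i)**: `‖v n - p‖` is nonincreasing when `T` is quasi-nonexpansive with respect
to `p` along the iteration. [cite: Berinde2007, Ch. 4 §4.2, Lemma 4.2, pp. 93–104] -/
theorem antitone_norm_mann_sub {p : E} (hc : ∀ n, c n ∈ Icc (0 : ℝ) 1)
    (hq : ∀ n, ‖T (v n) - p‖ ≤ ‖v n - p‖)
    (hv : ∀ n, v (n + 1) = (1 - c n) • v n + c n • T (v n)) :
    Antitone fun n => ‖v n - p‖ :=
  antitone_nat_of_succ_le fun n => norm_mann_succ_sub_le (hc n) (hq n) (hv n)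

omit [NormedSpace ℝ E] in
/-- **Lemma 4.2 (ii)**: if `‖v n - p‖` is nonincreasing and some subsequence `v ∘ φ` of `v`
converges to `p`, then `v n → p` (strict monotonicity of `φ` is not needed).
[cite: Berinde2007, Ch. 4 §4.2, Lemma 4.2, pp. 93–104] -/
theorem tendsto_of_antitone_of_subseq {p : E} (hanti : Antitone fun n => ‖v n - p‖)
    {φ : ℕ → ℕ} (h : Tendsto (v ∘ φ) atTop (𝓝 p)) : Tendsto v atTop (𝓝 p) := by
  rw [tendsto_iff_norm_sub_tendsto_zero] at h ⊢
  refine Metric.tendsto_atTop.2 fun ε hε => ?_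
  obtain ⟨k, hk⟩ := Metric.tendsto_atTop.1 h ε hε
  refine ⟨φ k, fun n hn => ?_⟩
  have h1 := hk k le_rfl
  rw [Real.dist_0_eq_abs, abs_of_nonneg (norm_nonneg _)] at h1 ⊢
  exact (hanti hn).trans_lt h1

omit [NormedSpace ℝ E] in
/-- **Lemma 4.2 (iii)**: if `‖v n - p‖` is nonincreasing and `y`, `z` are two subsequential
limits of `v`, then `‖y - p‖ = ‖z - p‖`. [cite: Berinde2007, Ch. 4 §4.2, Lemma 4.2, pp. 93–104] -/
theorem norm_sub_eq_of_subseq_tendsto {p y z : E} (hanti : Antitone fun n => ‖v n - p‖)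
    {φ ψ : ℕ → ℕ} (hφ : StrictMono φ) (hψ : StrictMono ψ) (hy : Tendsto (v ∘ φ) atTop (𝓝 y))
    (hz : Tendsto (v ∘ ψ) atTop (𝓝 z)) : ‖y - p‖ = ‖z - p‖ := by
  have hbdd : BddBelow (range fun n => ‖v n - p‖) :=
    ⟨0, by rintro _ ⟨n, rfl⟩; exact norm_nonneg _⟩
  have hlim := tendsto_atTop_ciInf hanti hbdd
  have h1 : Tendsto (fun k => ‖(v ∘ φ) k - p‖) atTop (𝓝 ‖y - p‖) := (hy.sub_const p).norm
  have h2 : Tendsto (fun k => ‖(v ∘ ψ) k - p‖) atTop (𝓝 ‖z - p‖) := (hz.sub_const p).norm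
  have h1' := tendsto_nhds_unique h1 (hlim.comp hφ.tendsto_atTop)
  have h2' := tendsto_nhds_unique h2 (hlim.comp hψ.tendsto_atTop)
  rw [h1', h2']

/-- **Theorem 4.4** (Dotson, Theorem 3): `E` a strictly convex Banach space, `C` closed convex,
`T` continuous on `C` with `T(C) ⊆ C`, quasi-nonexpansive on `C`, `T(C) ⊆ K` compact (so `T` has
a fixed point in `C` by Schauder's theorem, the tree's `exists_fixedPoint_of_mapsTo_isCompact`);
`c n ∈ [0,1]` with a subsequence converging to some `t ∈ (0,1)`.  Then the Mann sequence
`v (n+1) = (1 - c n) v n + c n T (v n)`, `v 0 ∈ C`, converges to a fixed point of `T` in `C`.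
[cite: Berinde2007, Ch. 4 §4.2, Theorem 4.4, pp. 93–104] -/
theorem exists_tendsto_of_strictConvexSpace [StrictConvexSpace ℝ E] [CompleteSpace E] {K : Set E}
    (hC : IsClosed C) (hconv : Convex ℝ C) (hTC : MapsTo T C C) (hT : ContinuousOn T C)
    (hq : ∀ p ∈ C, T p = p → ∀ x ∈ C, ‖T x - p‖ ≤ ‖x - p‖)
    (hK : IsCompact K) (hTK : MapsTo T C K) (hc : ∀ n, c n ∈ Icc (0 : ℝ) 1)
    (hcl : ∃ t ∈ Ioo (0 : ℝ) 1, ∃ φ : ℕ → ℕ, StrictMono φ ∧ Tendsto (c ∘ φ) atTop (𝓝 t))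
    (hv0 : v 0 ∈ C) (hv : ∀ n, v (n + 1) = (1 - c n) • v n + c n • T (v n)) :
    ∃ y ∈ C, T y = y ∧ Tendsto v atTop (𝓝 y) := by
  have hvC : ∀ n, v n ∈ C := mann_mem hconv hTC hc hv0 hv
  -- the iterates lie in the compact set `closure (conv ({v 0} ∪ K))`
  have hvH : ∀ n, v n ∈ convexHull ℝ (insert (v 0) K) := by
    intro n
    induction n with
    | zero => exact subset_convexHull ℝ _ (mem_insert _ _)
    | succ n ih =>
      rw [hv n]
      exact convex_convexHull ℝ _ ih
        (subset_convexHull ℝ _ (mem_insert_of_mem _ (hTK (hvC n))))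
        (sub_nonneg.2 (hc n).2) (hc n).1 (sub_add_cancel 1 (c n))
  have hHc : IsCompact (closure (convexHull ℝ (insert (v 0) K))) :=
    (totallyBounded_convexHull E (hK.insert (v 0)).totallyBounded).closure.isCompact_of_isClosed
      isClosed_closure
  obtain ⟨t, ht, φ, hφ, hcφ⟩ := hcl
  obtain ⟨y, -, ψ, hψ, hy⟩ :=
    hHc.tendsto_subseq (x := v ∘ φ) fun k => subset_closure (hvH (φ k))
  have hy' : Tendsto (fun k => v (φ (ψ k))) atTop (𝓝 y) := hy
  have hyC : y ∈ C := hC.mem_of_tendsto hy' (Eventually.of_forall fun k => hvC _)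
  -- Schauder's fixed point theorem (tree: `Literature.Analysis.Convex.SchauderFixedPoint`)
  obtain ⟨p, hpC, hp⟩ := exists_fixedPoint_of_mapsTo_isCompact hconv hC ⟨v 0, hv0⟩ hK hT hTC hTK
  have hanti : Antitone fun n => ‖v n - p‖ :=
    antitone_norm_mann_sub hc (fun n => hq p hpC hp _ (hvC n)) hv
  have hTy : Tendsto (fun k => T (v (φ (ψ k)))) atTop (𝓝 (T y)) :=
    (hT y hyC).tendsto.comp (tendsto_nhdsWithin_iff.2 ⟨hy', Eventually.of_forall fun k => hvC _⟩)
  have hck : Tendsto (fun k => c (φ (ψ k))) atTop (𝓝 t) := hcφ.comp hψ.tendsto_atTop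
  have hsucc : Tendsto (fun k => v (φ (ψ k) + 1)) atTop (𝓝 ((1 - t) • y + t • T y)) := by
    simp only [hv]
    exact ((tendsto_const_nhds.sub hck).smul hy').add (hck.smul hTy)
  have hmono : StrictMono fun k => φ (ψ k) + 1 := fun i j h => Nat.add_lt_add_right (hφ (hψ h)) 1
  -- Lemma 4.2 (iii): `y` and `(1-t) y + t T y` are equidistant from `p`
  have heq : ‖((1 - t) • y + t • T y) - p‖ = ‖y - p‖ :=
    norm_sub_eq_of_subseq_tendsto hanti hmono (hφ.comp hψ) hsucc hy
  have hid : ((1 - t) • y + t • T y) - p = (1 - t) • (y - p) + t • (T y - p) := by module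
  rw [hid] at heq
  -- Lemma 4.1
  have hfix : y - p = T y - p := eq_of_norm_combo_eq ht (hq p hpC hp y hyC) heq
  have hTyy : T y = y := (sub_left_injective hfix).symm
  refine ⟨y, hyC, hTyy, ?_⟩
  -- Lemma 4.2 (ii) at the fixed point `y`
  exact tendsto_of_antitone_of_subseq (φ := fun k => φ (ψ k))
    (antitone_norm_mann_sub hc (fun n => hq y hyC hTyy _ (hvC n)) hv) hy'

/-- **Theorem 4.4** in the book's form for a normal Mann process `M(x₁, A, T)`: under the
hypotheses of `exists_tendsto_of_strictConvexSpace` on `E, C, T`, with `A` satisfying (A₁), (A₂),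
(A₄) and its diagonal `a (n+1) (n+1)` clustering at some `t ∈ (0,1)`, both sequences `x_n` and
`v_n` converge to the same fixed point of `T`.
[cite: Berinde2007, Ch. 4 §4.2, Theorem 4.4, pp. 93–104] -/
theorem IsMannProcess.exists_tendsto_of_normal [StrictConvexSpace ℝ E] [CompleteSpace E]
    {a : ℕ → ℕ → ℝ} {x₀ : E} {x : ℕ → E} {K : Set E} (hP : IsMannProcess a T x₀ x v)
    (hA : IsMannMatrix a) (h4 : IsNormalRec a)
    (hcl : ∃ t ∈ Ioo (0 : ℝ) 1, ∃ φ : ℕ → ℕ, StrictMono φ ∧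
      Tendsto (fun k => a (φ k + 1) (φ k + 1)) atTop (𝓝 t))
    (hC : IsClosed C) (hconv : Convex ℝ C) (hTC : MapsTo T C C) (hT : ContinuousOn T C)
    (hq : ∀ p ∈ C, T p = p → ∀ x ∈ C, ‖T x - p‖ ≤ ‖x - p‖)
    (hK : IsCompact K) (hTK : MapsTo T C K) (hx₀ : x₀ ∈ C) :
    ∃ y ∈ C, T y = y ∧ Tendsto x atTop (𝓝 y) ∧ Tendsto v atTop (𝓝 y) := by
  have hv0 : v 0 ∈ C := by rw [hP.v_zero hA]; exact hx₀
  obtain ⟨y, hyC, hTy, hvy⟩ := exists_tendsto_of_strictConvexSpace (c := fun n => a (n + 1) (n + 1))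
    hC hconv hTC hT hq hK hTK (fun n => hA.diag_mem_Icc (n + 1)) hcl hv0 (hP.v_succ h4)
  refine ⟨y, hyC, hTy, ?_, hvy⟩
  have hvC : ∀ n, v n ∈ C := (hP.mem hA hconv hTC hx₀).2
  have hTv : Tendsto (fun n => T (v n)) atTop (𝓝 (T y)) :=
    (hT y hyC).tendsto.comp (tendsto_nhdsWithin_iff.2 ⟨hvy, Eventually.of_forall hvC⟩)
  rw [hTy] at hTv
  have hx1 : Tendsto (fun n => x (n + 1)) atTop (𝓝 y) := by simpa only [hP.succ] using hTv
  exact (tendsto_add_atTop_iff_nat 1).1 hx1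

/-! ### Uniformly convex spaces: Lemma 4.3, Theorems 4.5, 4.6 -/

/-- The uniform-convexity estimate behind **Lemma 4.3**: for `0 < a ≤ t ≤ b < 1` and `ε > 0`
there is `δ > 0` with `‖(1 - t) w + t y‖ ≤ 1 - δ` whenever `‖w‖, ‖y‖ ≤ 1` and `‖w - y‖ ≥ ε`.
[cite: Berinde2007, Ch. 4 §4.2, Lemma 4.3 (Dotson 1970, Lemma 3; Schaefer), pp. 93–104] -/
theorem exists_norm_combo_le_one_sub [UniformConvexSpace E] {a b ε : ℝ} (ha : 0 < a) (hb : b < 1)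
    (hε : 0 < ε) :
    ∃ δ > 0, ∀ ⦃t : ℝ⦄, t ∈ Icc a b → ∀ ⦃w y : E⦄, ‖w‖ ≤ 1 → ‖y‖ ≤ 1 → ε ≤ ‖w - y‖ →
      ‖(1 - t) • w + t • y‖ ≤ 1 - δ := by
  obtain ⟨δ, hδ, hδ'⟩ := exists_forall_closed_ball_dist_add_le_two_sub E hε
  refine ⟨min a (1 - b) * δ, mul_pos (lt_min ha (sub_pos.2 hb)) hδ, fun t ht w y hw hy hwy => ?_⟩
  have hsum : ‖w + y‖ ≤ 2 - δ := hδ' hw hy hwy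
  rcases le_or_gt t (1 - t) with hle | hgt
  · have hid : (1 - t) • w + t • y = (1 - 2 * t) • w + t • (w + y) := by module
    rw [hid]
    calc ‖(1 - 2 * t) • w + t • (w + y)‖ ≤ ‖(1 - 2 * t) • w‖ + ‖t • (w + y)‖ := norm_add_le _ _
      _ = (1 - 2 * t) * ‖w‖ + t * ‖w + y‖ := by
          rw [norm_smul, norm_smul, Real.norm_of_nonneg (by linarith),
            Real.norm_of_nonneg (ha.le.trans ht.1)]
      _ ≤ (1 - 2 * t) * 1 + t * (2 - δ) := by
          gcongr
          · linarith
          · exact ha.le.trans ht.1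
      _ = 1 - t * δ := by ring
      _ ≤ 1 - min a (1 - b) * δ := by
          have h : min a (1 - b) * δ ≤ t * δ :=
            mul_le_mul_of_nonneg_right ((min_le_left a (1 - b)).trans ht.1) hδ.le
          linarith
  · have hid : (1 - t) • w + t • y = (2 * t - 1) • y + (1 - t) • (w + y) := by module
    rw [hid]
    calc ‖(2 * t - 1) • y + (1 - t) • (w + y)‖
        ≤ ‖(2 * t - 1) • y‖ + ‖(1 - t) • (w + y)‖ := norm_add_le _ _
      _ = (2 * t - 1) * ‖y‖ + (1 - t) * ‖w + y‖ := by
          rw [norm_smul, norm_smul, Real.norm_of_nonneg (by linarith),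
            Real.norm_of_nonneg (by linarith [ht.2])]
      _ ≤ (2 * t - 1) * 1 + (1 - t) * (2 - δ) := by
          gcongr
          · linarith
          · linarith [ht.2]
      _ = 1 - (1 - t) * δ := by ring
      _ ≤ 1 - min a (1 - b) * δ := by
          have hbt : 1 - b ≤ 1 - t := by linarith [ht.2]
          have h : min a (1 - b) * δ ≤ (1 - t) * δ :=
            mul_le_mul_of_nonneg_right ((min_le_right a (1 - b)).trans hbt) hδ.le
          linarith

/-- **Lemma 4.3** (Dotson, Lemma 3): `E` uniformly convex, `0 < a ≤ c n ≤ b < 1`,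
`‖w n‖ ≤ 1`, `‖y n‖ ≤ 1` and `‖(1 - c n) w n + c n y n‖ → 1` imply `‖w n - y n‖ → 0`.
[cite: Berinde2007, Ch. 4 §4.2, Lemma 4.3, pp. 93–104] -/
theorem tendsto_norm_sub_of_norm_combo_tendsto_one [UniformConvexSpace E] {a b : ℝ} (ha : 0 < a)
    (hb : b < 1) (hc : ∀ n, c n ∈ Icc a b) {w y : ℕ → E} (hw : ∀ n, ‖w n‖ ≤ 1)
    (hy : ∀ n, ‖y n‖ ≤ 1)
    (hz : Tendsto (fun n => ‖(1 - c n) • w n + c n • y n‖) atTop (𝓝 1)) :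
    Tendsto (fun n => ‖w n - y n‖) atTop (𝓝 0) := by
  refine Metric.tendsto_atTop.2 fun ε hε => ?_
  obtain ⟨δ, hδ, hδ'⟩ := exists_norm_combo_le_one_sub (E := E) ha hb hε
  obtain ⟨N, hN⟩ := Metric.tendsto_atTop.1 hz δ hδ
  refine ⟨N, fun n hn => ?_⟩
  rw [Real.dist_0_eq_abs, abs_of_nonneg (norm_nonneg _)]
  by_contra hge
  have h1 := hδ' (hc n) (hw n) (hy n) (not_lt.1 hge)
  have h2 := hN n hn
  rw [Real.dist_eq, abs_lt] at h2
  linarith [h2.1]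

/-- **Theorem 4.5** (Dotson, Theorem 4): `E` uniformly convex, `0 < a ≤ c n ≤ b < 1`, and `T`
quasi-nonexpansive with respect to a point `p` along the Mann iteration
`v (n+1) = (1 - c n) v n + c n T (v n)` (e.g. `p` a fixed point of a quasi-nonexpansive
`T : C → C`).  Then `‖T (v n) - v n‖ → 0`.
[cite: Berinde2007, Ch. 4 §4.2, Theorem 4.5, pp. 93–104] -/
theorem tendsto_norm_apply_sub_self [UniformConvexSpace E] {a b : ℝ} (ha : 0 < a) (hb : b < 1)
    (hc : ∀ n, c n ∈ Icc a b) {p : E} (hq : ∀ n, ‖T (v n) - p‖ ≤ ‖v n - p‖)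
    (hv : ∀ n, v (n + 1) = (1 - c n) • v n + c n • T (v n)) :
    Tendsto (fun n => ‖T (v n) - v n‖) atTop (𝓝 0) := by
  have hc01 : ∀ n, c n ∈ Icc (0 : ℝ) 1 := fun n => ⟨ha.le.trans (hc n).1, (hc n).2.trans hb.le⟩
  obtain ⟨d, hd⟩ : ∃ d : ℕ → ℝ, ∀ n, d n = ‖v n - p‖ := ⟨_, fun _ => rfl⟩
  have hsucc : ∀ n, d (n + 1) ≤ d n := fun n => by
    rw [hd, hd]; exact norm_mann_succ_sub_le (hc01 n) (hq n) (hv n)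
  have hanti : Antitone d := antitone_nat_of_succ_le hsucc
  have hd0 : ∀ n, 0 ≤ d n := fun n => by rw [hd]; exact norm_nonneg _
  have hbdd : BddBelow (range d) := ⟨0, by rintro _ ⟨n, rfl⟩; exact hd0 n⟩
  have hlim : Tendsto d atTop (𝓝 (⨅ n, d n)) := tendsto_atTop_ciInf hanti hbdd
  have hLle : ∀ n, (⨅ n, d n) ≤ d n := fun n => ciInf_le hbdd n
  have hL0 : 0 ≤ ⨅ n, d n := le_ciInf hd0
  have hbound : ∀ n, ‖T (v n) - v n‖ ≤ 2 * d n := fun n => by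
    calc ‖T (v n) - v n‖ = ‖(T (v n) - p) - (v n - p)‖ := by rw [sub_sub_sub_cancel_right]
      _ ≤ ‖T (v n) - p‖ + ‖v n - p‖ := norm_sub_le _ _
      _ ≤ d n + d n := by rw [hd]; exact add_le_add (hq n) le_rfl
      _ = 2 * d n := by ring
  rcases hL0.eq_or_lt with hL | hLpos
  · -- the distances to `p` tend to `0`
    have h2 : Tendsto (fun n => 2 * d n) atTop (𝓝 0) := by
      have h := hlim.const_mul 2
      rwa [← hL, mul_zero] at h
    exact squeeze_zero (fun n => norm_nonneg _) hbound h2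
  · -- the distances stay above `d > 0`: normalise and use Lemma 4.3
    have hdpos : ∀ n, 0 < d n := fun n => hLpos.trans_le (hLle n)
    have hw : ∀ n, ‖(d n)⁻¹ • (v n - p)‖ ≤ 1 := fun n => by
      rw [norm_smul, norm_inv, Real.norm_of_nonneg (hd0 n), ← hd, inv_mul_cancel₀ (hdpos n).ne']
    have hy : ∀ n, ‖(d n)⁻¹ • (T (v n) - p)‖ ≤ 1 := fun n => by
      rw [norm_smul, norm_inv, Real.norm_of_nonneg (hd0 n)]
      exact (inv_mul_le_iff₀ (hdpos n)).2 (by rw [mul_one, hd]; exact hq n)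
    have hz_eq : ∀ n, (1 - c n) • ((d n)⁻¹ • (v n - p)) + c n • ((d n)⁻¹ • (T (v n) - p)) =
        (d n)⁻¹ • (v (n + 1) - p) := fun n => by rw [hv n]; module
    have h1 : Tendsto (fun n => d (n + 1) / d n) atTop (𝓝 1) := by
      have h := (hlim.comp (tendsto_add_atTop_nat 1)).div hlim hLpos.ne'
      rw [div_self hLpos.ne'] at h
      exact h
    have hz : Tendsto (fun n => ‖(1 - c n) • ((d n)⁻¹ • (v n - p)) +
        c n • ((d n)⁻¹ • (T (v n) - p))‖) atTop (𝓝 1) := by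
      refine h1.congr fun n => ?_
      rw [hz_eq, norm_smul, norm_inv, Real.norm_of_nonneg (hd0 n), ← hd, div_eq_inv_mul]
    have hwy := tendsto_norm_sub_of_norm_combo_tendsto_one ha hb hc hw hy hz
    have hkey : ∀ n, ‖T (v n) - v n‖ =
        d n * ‖(d n)⁻¹ • (v n - p) - (d n)⁻¹ • (T (v n) - p)‖ := fun n => by
      rw [← smul_sub, sub_sub_sub_cancel_right, norm_smul, norm_inv, Real.norm_of_nonneg (hd0 n),
        ← mul_assoc, mul_inv_cancel₀ (hdpos n).ne', one_mul, norm_sub_rev]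
    have h3 : Tendsto (fun n => d 0 * ‖(d n)⁻¹ • (v n - p) - (d n)⁻¹ • (T (v n) - p)‖)
        atTop (𝓝 0) := by
      have h := hwy.const_mul (d 0)
      rwa [mul_zero] at h
    refine squeeze_zero (fun n => norm_nonneg _) (fun n => ?_) h3
    rw [hkey n]
    exact mul_le_mul_of_nonneg_right (hanti (Nat.zero_le n)) (norm_nonneg _)

/-- **Theorem 4.5**, conclusion as printed: the Mann process is asymptotically regular,
`v (n+1) - v n → 0`. [cite: Berinde2007, Ch. 4 §4.2, Theorem 4.5, pp. 93–104] -/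
theorem tendsto_mann_succ_sub [UniformConvexSpace E] {a b : ℝ} (ha : 0 < a) (hb : b < 1)
    (hc : ∀ n, c n ∈ Icc a b) {p : E} (hq : ∀ n, ‖T (v n) - p‖ ≤ ‖v n - p‖)
    (hv : ∀ n, v (n + 1) = (1 - c n) • v n + c n • T (v n)) :
    Tendsto (fun n => v (n + 1) - v n) atTop (𝓝 0) := by
  rw [tendsto_zero_iff_norm_tendsto_zero]
  refine squeeze_zero (fun n => norm_nonneg _) (fun n => ?_)
    (tendsto_norm_apply_sub_self ha hb hc hq hv)
  have hid : v (n + 1) - v n = c n • (T (v n) - v n) := by rw [hv n]; module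
  rw [hid, norm_smul, Real.norm_of_nonneg (ha.le.trans (hc n).1)]
  exact mul_le_of_le_one_left (norm_nonneg _) ((hc n).2.trans hb.le)

/-- **Corollary 4.1** (Browder–Petryshyn [BrP67]): `E` uniformly convex, `T` nonexpansive with a
fixed point; then for `0 < t < 1` the averaged map `T_t = (1 - t) I + t T` is asymptotically
regular: `x_n - x_{n+1} → 0` along `x (n+1) = T_t (x n)`.
[cite: Berinde2007, Ch. 4 §4.2, Corollary 4.1, pp. 93–104] -/
theorem tendsto_succ_sub_of_nonexpansive [UniformConvexSpace E] {t : ℝ} (ht : t ∈ Ioo (0 : ℝ) 1)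
    (hT : ∀ x y, ‖T x - T y‖ ≤ ‖x - y‖) {p : E} (hp : T p = p) {x : ℕ → E}
    (hx : ∀ n, x (n + 1) = (1 - t) • x n + t • T (x n)) :
    Tendsto (fun n => x n - x (n + 1)) atTop (𝓝 0) := by
  have h := tendsto_mann_succ_sub (c := fun _ => t) (v := x) ht.1 ht.2 (fun _ => ⟨le_rfl, le_rfl⟩)
    (p := p) (fun n => by simpa only [hp] using hT (x n) p) hx
  have h' := h.neg
  rw [neg_zero] at h'
  exact h'.congr fun n => neg_sub _ _

/-- The sequential closed-graph property of `I - T` on `C` used in **Theorem 4.6**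
("`I - T` is closed": if `u n ∈ C`, `u n → y ∈ C` and `u n - T (u n) → w` then
`y - T y = w`). [cite: Berinde2007, Ch. 4 §4.2, Theorem 4.6, pp. 93–104] -/
def graphClosedOn (T : E → E) (C : Set E) : Prop :=
  ∀ ⦃u : ℕ → E⦄ ⦃y w : E⦄, (∀ n, u n ∈ C) → y ∈ C → Tendsto u atTop (𝓝 y) →
    Tendsto (fun n => u n - T (u n)) atTop (𝓝 w) → y - T y = w

omit [NormedSpace ℝ E] in
/-- **Remark 1** after Theorem 4.6: if `T` is continuous on `C` then `I - T` is closed on `C`.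
[cite: Berinde2007, Ch. 4 §4.2, Remark 1, pp. 93–104] -/
theorem graph_closed_of_continuousOn (hT : ContinuousOn T C) : graphClosedOn T C := by
  intro u y w huC hyC hu hw
  have hTu : Tendsto (fun n => T (u n)) atTop (𝓝 (T y)) :=
    (hT y hyC).tendsto.comp (tendsto_nhdsWithin_iff.2 ⟨hu, Eventually.of_forall huC⟩)
  exact tendsto_nhds_unique (hu.sub hTu) hw

/-- **Theorem 4.6** (Dotson, Theorem 5): `E` uniformly convex, `C` closed convex, `T : C → C`
quasi-nonexpansive with a fixed point, `I - T` closed on `C`, `0 < a ≤ c n ≤ b < 1`.  If the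
Mann sequence has a subsequence converging to `y`, then `y ∈ C`, `T y = y` and `v n → y`.
[cite: Berinde2007, Ch. 4 §4.2, Theorem 4.6, pp. 93–104] -/
theorem tendsto_of_subseq_tendsto_of_graph_closed [UniformConvexSpace E] {a b : ℝ} (ha : 0 < a)
    (hb : b < 1) (hc : ∀ n, c n ∈ Icc a b) (hC : IsClosed C) (hconv : Convex ℝ C)
    (hTC : MapsTo T C C) (hq : ∀ p ∈ C, T p = p → ∀ x ∈ C, ‖T x - p‖ ≤ ‖x - p‖)
    (hF : ∃ p ∈ C, T p = p) (hIT : graphClosedOn T C) (hv0 : v 0 ∈ C)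
    (hv : ∀ n, v (n + 1) = (1 - c n) • v n + c n • T (v n)) {y : E} {φ : ℕ → ℕ}
    (hφ : StrictMono φ) (hy : Tendsto (v ∘ φ) atTop (𝓝 y)) :
    y ∈ C ∧ T y = y ∧ Tendsto v atTop (𝓝 y) := by
  have hc01 : ∀ n, c n ∈ Icc (0 : ℝ) 1 := fun n => ⟨ha.le.trans (hc n).1, (hc n).2.trans hb.le⟩
  have hvC : ∀ n, v n ∈ C := mann_mem hconv hTC hc01 hv0 hv
  have hyC : y ∈ C := hC.mem_of_tendsto hy (Eventually.of_forall fun k => hvC _)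
  obtain ⟨p, hpC, hp⟩ := hF
  have hres : Tendsto (fun n => v n - T (v n)) atTop (𝓝 0) := by
    rw [tendsto_zero_iff_norm_tendsto_zero]
    exact (tendsto_norm_apply_sub_self ha hb hc (fun n => hq p hpC hp _ (hvC n)) hv).congr
      fun n => norm_sub_rev _ _
  have hTy : y - T y = 0 :=
    hIT (fun k => hvC (φ k)) hyC hy (hres.comp hφ.tendsto_atTop)
  have hTyy : T y = y := (sub_eq_zero.1 hTy).symm
  exact ⟨hyC, hTyy, tendsto_of_antitone_of_subseq
    (antitone_norm_mann_sub hc01 (fun n => hq y hyC hTyy _ (hvC n)) hv) hy⟩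

omit [NormedSpace ℝ E] in
/-- The remark after Theorems 4.4/4.6: if `v n → y` and `‖T (v n) - v n‖ → 0` then also
`x (n+1) = T (v n) → y`. [cite: Berinde2007, Ch. 4 §4.2, proof of Theorem 4.6, pp. 93–104] -/
theorem tendsto_apply_of_tendsto {y : E} (hvy : Tendsto v atTop (𝓝 y))
    (hres : Tendsto (fun n => ‖T (v n) - v n‖) atTop (𝓝 0)) :
    Tendsto (fun n => T (v n)) atTop (𝓝 y) := by
  rw [← tendsto_zero_iff_norm_tendsto_zero] at hres
  have h := hres.add hvy
  rw [zero_add] at h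
  exact h.congr fun n => sub_add_cancel _ _

/-! ### Theorem 4.7 (i), (iii): weak cluster points (the parts not using reflexivity) -/

/-- The book's Definition before Theorem 4.7 in sequential form: `I - T` is *demiclosed* on `C`
if `u n ∈ C`, `u n ⇀ y ∈ C` weakly (in Mathlib's `WeakSpace ℝ E`) and `u n - T (u n) → w`
strongly imply `y - T y = w`.
[cite: Berinde2007, Ch. 4 §4.2, Definition (demiclosed), pp. 93–104] -/
def demiclosedOn (T : E → E) (C : Set E) : Prop :=
  ∀ ⦃u : ℕ → E⦄ ⦃y w : E⦄, (∀ n, u n ∈ C) → y ∈ C →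
    Tendsto (fun n => toWeakSpace ℝ E (u n)) atTop (𝓝 (toWeakSpace ℝ E y)) →
    Tendsto (fun n => u n - T (u n)) atTop (𝓝 w) → y - T y = w

/-- `I - T` is *weakly closed* on `C` (Theorem 4.7 (iii)), sequential form: `u n ∈ C`,
`u n ⇀ y ∈ C` and `u n - T (u n) ⇀ w` imply `y - T y = w`.
[cite: Berinde2007, Ch. 4 §4.2, Theorem 4.7 (iii), pp. 93–104] -/
def weaklyClosedOn (T : E → E) (C : Set E) : Prop :=
  ∀ ⦃u : ℕ → E⦄ ⦃y w : E⦄, (∀ n, u n ∈ C) → y ∈ C →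
    Tendsto (fun n => toWeakSpace ℝ E (u n)) atTop (𝓝 (toWeakSpace ℝ E y)) →
    Tendsto (fun n => toWeakSpace ℝ E (u n - T (u n))) atTop (𝓝 (toWeakSpace ℝ E w)) →
    y - T y = w

/-- A weakly closed `I - T` is demiclosed (strong convergence implies weak convergence).
[cite: Berinde2007, Ch. 4 §4.2, Theorem 4.7 (iii), pp. 93–104] -/
theorem demiclosedOn_of_weaklyClosedOn (h : weaklyClosedOn T C) : demiclosedOn T C :=
  fun _ _ w huC hyC hu hw =>
    h huC hyC hu (((toWeakSpaceCLM ℝ E).continuous.tendsto w).comp hw)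

/-- **Theorem 4.7 (i)**, second assertion (and, via `demiclosedOn_of_weaklyClosedOn`, the first
assertion of (iii)): `E` uniformly convex, `T : C → C` quasi-nonexpansive with a fixed point,
`0 < a ≤ c n ≤ b < 1`, `I - T` demiclosed on `C`.  Then every weak subsequential limit `y ∈ C`
of the Mann sequence is a fixed point of `T`.  (The existence of weak cluster points — `E` is
reflexive and `v` is bounded — and parts (ii), (iii) second half are not formalised.)
[cite: Berinde2007, Ch. 4 §4.2, Theorem 4.7 (i), pp. 93–104] -/
theorem apply_eq_self_of_weak_subseq_tendsto [UniformConvexSpace E] {a b : ℝ} (ha : 0 < a)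
    (hb : b < 1) (hc : ∀ n, c n ∈ Icc a b) (hconv : Convex ℝ C) (hTC : MapsTo T C C)
    (hq : ∀ p ∈ C, T p = p → ∀ x ∈ C, ‖T x - p‖ ≤ ‖x - p‖) (hF : ∃ p ∈ C, T p = p)
    (hdemi : demiclosedOn T C) (hv0 : v 0 ∈ C)
    (hv : ∀ n, v (n + 1) = (1 - c n) • v n + c n • T (v n)) {y : E} (hyC : y ∈ C)
    {φ : ℕ → ℕ} (hφ : StrictMono φ)
    (hy : Tendsto (fun k => toWeakSpace ℝ E (v (φ k))) atTop (𝓝 (toWeakSpace ℝ E y))) :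
    T y = y := by
  have hc01 : ∀ n, c n ∈ Icc (0 : ℝ) 1 := fun n => ⟨ha.le.trans (hc n).1, (hc n).2.trans hb.le⟩
  have hvC : ∀ n, v n ∈ C := mann_mem hconv hTC hc01 hv0 hv
  obtain ⟨p, hpC, hp⟩ := hF
  have hres : Tendsto (fun n => v n - T (v n)) atTop (𝓝 0) := by
    rw [tendsto_zero_iff_norm_tendsto_zero]
    exact (tendsto_norm_apply_sub_self ha hb hc (fun n => hq p hpC hp _ (hvC n)) hv).congr
      fun n => norm_sub_rev _ _
  have h := hdemi (u := fun k => v (φ k)) (fun k => hvC (φ k)) hyC hy (hres.comp hφ.tendsto_atTop)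
  exact (sub_eq_zero.1 h).symm

/-! ### Condition (D) of Senter–Dotson, Lemma 4.5 and Theorem 4.8 -/

/-- **Definition 4.3**: `T` satisfies condition (D) on `C` (Senter–Dotson's Condition I) if there
is a nondecreasing `f` with `f 0 = 0`, `f r > 0` for `r > 0`, and
`‖x - T x‖ ≥ f (d (x, F(T)))` for all `x ∈ C`, `F(T) = {p ∈ C | T p = p}`.
[cite: Berinde2007, Ch. 4 §4.2, Definition 4.3, pp. 93–104] -/
def SatisfiesConditionD (T : E → E) (C : Set E) : Prop :=
  ∃ f : ℝ → ℝ, Monotone f ∧ f 0 = 0 ∧ (∀ r, 0 < r → 0 < f r) ∧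
    ∀ x ∈ C, f (infDist x {p ∈ C | T p = p}) ≤ ‖x - T x‖

omit [NormedSpace ℝ E] in
/-- The fixed point set in `C` of a map quasi-nonexpansive on a closed set `C` is closed
(Dotson 1972, Theorem 1; used on book p. 98).
[cite: Berinde2007, Ch. 4 §4.2, pp. 93–104 ("`F(T)` is always closed")] -/
theorem isClosed_fixedSet (hC : IsClosed C)
    (hq : ∀ p ∈ C, T p = p → ∀ x ∈ C, ‖T x - p‖ ≤ ‖x - p‖) :
    IsClosed {p ∈ C | T p = p} := by
  refine isSeqClosed_iff_isClosed.1 fun u q huF huq => ?_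
  have hqC : q ∈ C := hC.mem_of_tendsto huq (Eventually.of_forall fun n => (huF n).1)
  refine ⟨hqC, ?_⟩
  have h : Tendsto u atTop (𝓝 (T q)) := by
    rw [tendsto_iff_norm_sub_tendsto_zero] at huq ⊢
    refine squeeze_zero (fun n => norm_nonneg _) (fun n => ?_) huq
    rw [norm_sub_rev, norm_sub_rev (u n)]
    exact hq (u n) (huF n).1 (huF n).2 q hqC
  exact tendsto_nhds_unique h huq

omit [NormedSpace ℝ E] in
/-- A Fejér-monotone sequence whose distance to the (nonempty) target set tends to `0` is
Cauchy (the step "`{x_n}` is a Cauchy sequence" in Senter–Dotson's proof of Theorem 4.8).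
[cite: Berinde2007, Ch. 4 §4.2, Theorem 4.8 (proof: Senter–Dotson 1974, Theorem 1), pp. 93–104] -/
theorem cauchySeq_of_fejer_of_tendsto_infDist {F : Set E} (hF : F.Nonempty)
    (hmono : ∀ p ∈ F, ∀ n, ‖v (n + 1) - p‖ ≤ ‖v n - p‖)
    (hdist : Tendsto (fun n => infDist (v n) F) atTop (𝓝 0)) : CauchySeq v := by
  refine Metric.cauchySeq_iff.2 fun ε hε => ?_
  obtain ⟨N, hN⟩ := Metric.tendsto_atTop.1 hdist (ε / 2) (half_pos hε)
  have h := hN N le_rfl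
  rw [Real.dist_0_eq_abs, abs_of_nonneg infDist_nonneg, infDist_lt_iff hF] at h
  obtain ⟨p, hpF, hp⟩ := h
  have hanti' : Antitone fun n => ‖v n - p‖ := antitone_nat_of_succ_le (hmono p hpF)
  have hanti : ∀ n ≥ N, ‖v n - p‖ ≤ ‖v N - p‖ := fun n hn => hanti' hn
  refine ⟨N, fun m hm n hn => ?_⟩
  rw [dist_eq_norm] at hp ⊢
  calc ‖v m - v n‖ = ‖(v m - p) - (v n - p)‖ := by rw [sub_sub_sub_cancel_right]
    _ ≤ ‖v m - p‖ + ‖v n - p‖ := norm_sub_le _ _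
    _ < ε / 2 + ε / 2 := add_lt_add ((hanti m hm).trans_lt hp) ((hanti n hn).trans_lt hp)
    _ = ε := by ring

/-- **Theorem 4.8** in the generality of Senter–Dotson, Theorem 2: `E` uniformly convex Banach,
`C` closed convex, `T : C → C` quasi-nonexpansive with `F(T) ≠ ∅` satisfying condition (D),
`0 < a ≤ c n ≤ b < 1`.  Then the Mann sequence `v (n+1) = (1 - c n) v n + c n T (v n)`,
`v 0 ∈ C`, converges to a fixed point of `T`.
[cite: Berinde2007, Ch. 4 §4.2, Theorem 4.8 and the paragraph after it, pp. 93–104] -/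
theorem exists_tendsto_of_conditionD [UniformConvexSpace E] [CompleteSpace E] {a b : ℝ}
    (ha : 0 < a) (hb : b < 1) (hc : ∀ n, c n ∈ Icc a b) (hC : IsClosed C) (hconv : Convex ℝ C)
    (hTC : MapsTo T C C) (hq : ∀ p ∈ C, T p = p → ∀ x ∈ C, ‖T x - p‖ ≤ ‖x - p‖)
    (hF : ∃ p ∈ C, T p = p) (hD : SatisfiesConditionD T C) (hv0 : v 0 ∈ C)
    (hv : ∀ n, v (n + 1) = (1 - c n) • v n + c n • T (v n)) :
    ∃ p ∈ C, T p = p ∧ Tendsto v atTop (𝓝 p) := by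
  set F : Set E := {p ∈ C | T p = p} with hFdef
  have hc01 : ∀ n, c n ∈ Icc (0 : ℝ) 1 := fun n => ⟨ha.le.trans (hc n).1, (hc n).2.trans hb.le⟩
  have hvC : ∀ n, v n ∈ C := mann_mem hconv hTC hc01 hv0 hv
  obtain ⟨p₀, hp₀C, hp₀⟩ := hF
  have hFne : F.Nonempty := ⟨p₀, hp₀C, hp₀⟩
  have hmono : ∀ p ∈ F, ∀ n, ‖v (n + 1) - p‖ ≤ ‖v n - p‖ := fun p hp n =>
    norm_mann_succ_sub_le (hc01 n) (hq p hp.1 hp.2 _ (hvC n)) (hv n)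
  -- Theorem 4.5: `‖v n - T v n‖ → 0`
  have hres : Tendsto (fun n => ‖v n - T (v n)‖) atTop (𝓝 0) :=
    (tendsto_norm_apply_sub_self ha hb hc (fun n => hq p₀ hp₀C hp₀ _ (hvC n)) hv).congr
      fun n => norm_sub_rev _ _
  -- condition (D): `d(v n, F) → 0`
  obtain ⟨f, hfm, -, hfpos, hfD⟩ := hD
  have hdist : Tendsto (fun n => infDist (v n) F) atTop (𝓝 0) := by
    refine Metric.tendsto_atTop.2 fun ε hε => ?_
    obtain ⟨N, hN⟩ := Metric.tendsto_atTop.1 hres (f ε) (hfpos ε hε)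
    refine ⟨N, fun n hn => ?_⟩
    rw [Real.dist_0_eq_abs, abs_of_nonneg infDist_nonneg]
    by_contra hge
    have h1 := hN n hn
    rw [Real.dist_0_eq_abs, abs_of_nonneg (norm_nonneg _)] at h1
    have h2 : f ε ≤ f (infDist (v n) F) := hfm (not_lt.1 hge)
    linarith [hfD (v n) (hvC n)]
  -- Cauchy, hence convergent; the limit lies in the closed set `F`
  obtain ⟨q, hq'⟩ :=
    cauchySeq_tendsto_of_complete (cauchySeq_of_fejer_of_tendsto_infDist hFne hmono hdist)
  have hqF : q ∈ F := by
    have h1 : Tendsto (fun n => infDist (v n) F) atTop (𝓝 (infDist q F)) :=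
      ((continuous_infDist_pt F).tendsto q).comp hq'
    have h0 : infDist q F = 0 := tendsto_nhds_unique h1 hdist
    have hcl := (mem_closure_iff_infDist_zero hFne).2 h0
    rwa [(isClosed_fixedSet hC hq).closure_eq] at hcl
  exact ⟨q, hqF.1, hqF.2, hq'⟩

/-- **Theorem 4.8** as printed (Senter–Dotson, Theorem 1): `E` uniformly convex Banach, `C`
closed convex, `T : C → C` nonexpansive with a fixed point in `C` (in the book: `C` bounded, and
the fixed point comes from the Browder–Göhde–Kirk theorem) and satisfying condition (D),
`0 < a ≤ c n ≤ b < 1`: the Mann sequence converges to a fixed point of `T`.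
[cite: Berinde2007, Ch. 4 §4.2, Theorem 4.8, pp. 93–104] -/
theorem exists_tendsto_of_conditionD_of_nonexpansive [UniformConvexSpace E] [CompleteSpace E]
    {a b : ℝ} (ha : 0 < a) (hb : b < 1) (hc : ∀ n, c n ∈ Icc a b) (hC : IsClosed C)
    (hconv : Convex ℝ C) (hTC : MapsTo T C C) (hT : ∀ x ∈ C, ∀ y ∈ C, ‖T x - T y‖ ≤ ‖x - y‖)
    (hF : ∃ p ∈ C, T p = p) (hD : SatisfiesConditionD T C) (hv0 : v 0 ∈ C)
    (hv : ∀ n, v (n + 1) = (1 - c n) • v n + c n • T (v n)) :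
    ∃ p ∈ C, T p = p ∧ Tendsto v atTop (𝓝 p) :=
  exists_tendsto_of_conditionD ha hb hc hC hconv hTC
    (fun p hpC hp x hx => by simpa only [hp] using hT x hx p hpC) hF hD hv0 hv

omit [NormedSpace ℝ E] in
/-- **Lemma 4.5** (Senter–Dotson, Lemma 1): `C` closed and bounded, `T : C → C` with a fixed
point in `C`; if `I - T` maps closed bounded subsets of `C` onto closed sets, then `T` satisfies
condition (D) on `C`. [cite: Berinde2007, Ch. 4 §4.2, Lemma 4.5, pp. 93–104] -/
theorem satisfiesConditionD_of_image_closed (hC : IsClosed C) (hCb : Bornology.IsBounded C)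
    (hF : ∃ p ∈ C, T p = p)
    (hIT : ∀ S ⊆ C, IsClosed S → Bornology.IsBounded S → IsClosed ((fun x => x - T x) '' S)) :
    SatisfiesConditionD T C := by
  set F : Set E := {p ∈ C | T p = p} with hFdef
  -- `A r = {1} ∪ {min 1 ‖x - T x‖ : x ∈ C, d(x, F) ≥ r}` and `f r = inf (A r)`
  set g : E → ℝ := fun x => min 1 ‖x - T x‖ with hg
  set A : ℝ → Set ℝ := fun r => insert 1 (g '' {x ∈ C | r ≤ infDist x F}) with hA
  have hAne : ∀ r, (A r).Nonempty := fun r => ⟨1, mem_insert _ _⟩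
  have hA0 : ∀ r, ∀ s ∈ A r, 0 ≤ s := by
    rintro r s (rfl | ⟨x, -, rfl⟩)
    · exact zero_le_one
    · exact le_min zero_le_one (norm_nonneg _)
  have hA1 : ∀ r, ∀ s ∈ A r, s ≤ 1 := by
    rintro r s (rfl | ⟨x, -, rfl⟩)
    · exact le_rfl
    · exact min_le_left _ _
  have hAbdd : ∀ r, BddBelow (A r) := fun r => ⟨0, hA0 r⟩
  have hAmono : ∀ ⦃r s⦄, r ≤ s → A s ⊆ A r := fun r s hrs =>
    insert_subset_insert (image_mono fun x hx => ⟨hx.1, hrs.trans hx.2⟩)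
  obtain ⟨p₀, hp₀C, hp₀⟩ := hF
  refine ⟨fun r => sInf (A r), fun r s hrs => csInf_le_csInf (hAbdd r) (hAne s) (hAmono hrs),
    ?_, fun r hr => ?_, fun x hx => ?_⟩
  · -- `f 0 = 0`: the fixed point `p₀` lies in `C_0` and `g p₀ = 0`
    show sInf (A 0) = 0
    refine le_antisymm (csInf_le (hAbdd 0) (mem_insert_of_mem _ ⟨p₀, ⟨hp₀C, infDist_nonneg⟩, ?_⟩))
      (le_csInf (hAne 0) (hA0 0))
    simp [hg, hp₀]
  · -- `f r > 0` for `r > 0`, by the closedness of `(I - T)(C_r)`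
    show 0 < sInf (A r)
    refine lt_of_le_of_ne (le_csInf (hAne r) (hA0 r)) fun h0 => ?_
    have hCr : IsClosed {x ∈ C | r ≤ infDist x F} :=
      hC.inter (isClosed_le continuous_const (continuous_infDist_pt F))
    have hcl : IsClosed ((fun x => x - T x) '' {x ∈ C | r ≤ infDist x F}) :=
      hIT _ (fun x hx => hx.1) hCr (hCb.subset fun x hx => hx.1)
    have hmem : (0 : E) ∈ (fun x => x - T x) '' {x ∈ C | r ≤ infDist x F} := by
      rw [← hcl.closure_eq, Metric.mem_closure_iff]
      intro ε hε
      have hlt : sInf (A r) < min ε 1 := by rw [← h0]; exact lt_min hε one_pos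
      obtain ⟨s, hs, hsε⟩ := (csInf_lt_iff (hAbdd r) (hAne r)).1 hlt
      rcases hs with rfl | ⟨x, hx, rfl⟩
      · exact absurd (hsε.trans_le (min_le_right _ _)) (lt_irrefl 1)
      · refine ⟨x - T x, ⟨x, hx, rfl⟩, ?_⟩
        rw [dist_eq_norm, zero_sub, norm_neg]
        have hsε' : min 1 ‖x - T x‖ < min ε 1 := hsε
        rcases le_or_gt 1 ‖x - T x‖ with h1 | h1
        · rw [min_eq_left h1] at hsε'
          exact absurd (hsε'.trans_le (min_le_right _ _)) (lt_irrefl 1)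
        · rw [min_eq_right h1.le] at hsε'
          exact hsε'.trans_le (min_le_left _ _)
    obtain ⟨z, hz, hz0⟩ := hmem
    have hzF : z ∈ F := ⟨hz.1, (sub_eq_zero.1 hz0).symm⟩
    have : infDist z F = 0 := infDist_zero_of_mem hzF
    linarith [hz.2]
  · -- the defining inequality of condition (D)
    show sInf (A (infDist x F)) ≤ ‖x - T x‖
    calc sInf (A (infDist x F)) ≤ g x :=
          csInf_le (hAbdd _) (mem_insert_of_mem _ ⟨x, ⟨hx, le_rfl⟩, rfl⟩)
      _ ≤ ‖x - T x‖ := min_le_right _ _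

/-! ### Example 4.2 (Senter–Dotson): the norm-only part -/

/-- The map of **Example 4.2**, `T u = ‖u‖ • e` for a fixed unit vector `e` (in the book
`E = ℝ²`, `e = (0, 1)` and `T(r, θ) = (r, π/2)` in polar coordinates).
[cite: Berinde2007, Ch. 4 §4.2, Example 4.2, pp. 93–104] -/
noncomputable def normRayMap (e : E) (u : E) : E := ‖u‖ • e

/-- `T` of Example 4.2 is nonexpansive when `‖e‖ = 1`.
[cite: Berinde2007, Ch. 4 §4.2, Example 4.2, pp. 93–104] -/
theorem norm_normRayMap_sub_le {e : E} (he : ‖e‖ = 1) (u w : E) :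
    ‖normRayMap e u - normRayMap e w‖ ≤ ‖u - w‖ := by
  rw [normRayMap, normRayMap, ← sub_smul, norm_smul, he, mul_one, Real.norm_eq_abs]
  exact abs_norm_sub_norm_le u w

/-- The fixed points of `T` of Example 4.2 are exactly the points of the ray `{r • e | 0 ≤ r}`
(the segment `θ = π/2` of the book). [cite: Berinde2007, Ch. 4 §4.2, Example 4.2, pp. 93–104] -/
theorem normRayMap_eq_self_iff {e : E} (he : ‖e‖ = 1) {u : E} :
    normRayMap e u = u ↔ ∃ r : ℝ, 0 ≤ r ∧ u = r • e := by
  constructor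
  · intro h; exact ⟨‖u‖, norm_nonneg _, h.symm⟩
  · rintro ⟨r, hr, rfl⟩
    rw [normRayMap, norm_smul, he, mul_one, Real.norm_of_nonneg hr]

/-- Example 4.2, item 1): `T (T u) = T u`, so for `α_n ≡ 1` the iteration reaches the fixed point
`T u₀ = ‖u₀‖ • e` after one step. [cite: Berinde2007, Ch. 4 §4.2, Example 4.2 (1), pp. 93–104] -/
theorem normRayMap_normRayMap {e : E} (he : ‖e‖ = 1) (u : E) :
    normRayMap e (normRayMap e u) = normRayMap e u := by
  rw [normRayMap, normRayMap, norm_smul, he, mul_one, Real.norm_of_nonneg (norm_nonneg _)]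

/-- The remark on Example 4.2, item 2): in a strictly convex space a genuine Mann step strictly
decreases the norm when `‖T u₀‖ = ‖u₀‖` and `T u₀ ≠ u₀` (so the printed `r_{n+1} = r_n` fails
for the Euclidean plane). [cite: Berinde2007, Ch. 4 §4.2, Example 4.2 (2), pp. 93–104] -/
theorem norm_mann_step_lt [StrictConvexSpace ℝ E] {u w : E} {α : ℝ} (hα : α ∈ Ioo (0 : ℝ) 1)
    (hnorm : ‖w‖ = ‖u‖) (hne : u ≠ w) : ‖(1 - α) • u + α • w‖ < ‖u‖ :=
  norm_combo_lt_of_ne le_rfl hnorm.le hne (sub_pos.2 hα.2) hα.1 (sub_add_cancel 1 α)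

/-- In particular for `T = normRayMap e`: `‖(1 - α) u + α T u‖ < ‖u‖` unless `u` is a fixed point.
[cite: Berinde2007, Ch. 4 §4.2, Example 4.2 (2), pp. 93–104] -/
theorem norm_mann_step_normRayMap_lt [StrictConvexSpace ℝ E] {e u : E} (he : ‖e‖ = 1) {α : ℝ}
    (hα : α ∈ Ioo (0 : ℝ) 1) (hu : normRayMap e u ≠ u) :
    ‖(1 - α) • u + α • normRayMap e u‖ < ‖u‖ :=
  norm_mann_step_lt hα
    (by rw [normRayMap, norm_smul, he, mul_one, Real.norm_of_nonneg (norm_nonneg _)]) (Ne.symm hu)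

end Normal

end Literature.Analysis.Convex.MannQuasiNonexpansive
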